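import Literature.NumberTheory.LFunctions.HalaszRestrictedSharpProfile
import HarnessLib

/-!
# Restricted Halász without the polynomial factor, III: the window theorem

Topic `Literature/NumberTheory/LFunctions`.  Everything in this file is PROVED; no definitions, no named facts.
Third part of the series (`HalaszRestrictedSharpTwists.lean`: clustering of near-aligned twists and block freezing;
`HalaszRestrictedSharpProfile.lean`: the sharp per-`α` profile `Sharp.norm_LSeries_restr_sharp`).

Halász's theorem for block-restricted sums (`a = g̃ 1_𝒮`, `g` completely multiplicative with `|g| ≤ 1`,
`𝒮` = integers with a prime factor in every block of a system of small primes) is proved in the tree with the main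
term `(1 + M_½) e^{-M_½}`, `M_½ ≥ M/2` the minimum of the HALVED distance (`Halasz.Restricted.norm_restr_sum_le`;
windows `(x, νx]`: `Halasz.Restricted.norm_restr_interval_sum_le`).  In the window `|t - t₁| ≤ (log X)^{1/16}` of
Matomäki–Radziwiłł–Tao 2015, Proposition A.3 this yields the middle terms `(1 + M) e^{-M/2}` (pointwise,
`HalaszRestrictedWindow.lean`) or `(1 + M)² e^{-M}` (Gallagher), not the printed `(1 + M) e^{-M}`.  Here the
polynomial factor is removed: in the regime `34 M + C_r ≤ log log x` the restricted window sums are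
`≪ (ν - 1) x e^{-M/2}` with NO factor `(1 + M)` (`Halasz.Restricted.norm_restr_interval_sum_le_sharp`), `M` the minimum
of the FULL distance; squared over the window this is the printed `e^{-M}`.

* `Halasz.Restricted.Sharp.regime_facts` — from `34 M + 203 + 4C ≤ log log x` (and `Q ≤ exp(√log νx + 1)`, `L ≤ √log νx + 3`):
  the scale `α_m = e^{M/2}/log νx` satisfies the side conditions of `Sharp.norm_LSeries_restr_sharp` at `θ = 7/10`;
* `…key_log_ineq`, `…key_inv_ineq` — with `α₀ = 1/(2 log x)`, `α_c = e^{M-d}/log νx`, `α₁ = max(α₀, min(α_c, α_m))`: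
  `e^{-d/2} e^{-(M-d)} log(α₁/α₀) ≤ 2 e^{-M/2}` and `e^{-d/2}/α₁ ≤ 2 log νx · e^{-M/2}` (the reason the `α`-integral of
  the profile carries no factor `M`: `(v + 1) e^{-v/2} ≤ 2`);
* `…F_term_le` — the `F`-term estimate of `norm_restr_interval_sum_le`, isolated;
* `Halasz.Restricted.integral_profile_le` — from a per-`α` bound `c₁/α + c₂ min(c₃, 1/α) + c₄ α` on `(0, α_m]` to the
  `α`-integral of Granville–Soundararajan's representation (`inner_integral_restr_interval_le` in the three regimes
  `min ≤ c₃`, `min ≤ 1/α`, crude `e^{12}/α`, and `Halasz.setIntegral_le_of_three_regimes`);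
* `Halasz.Restricted.norm_restr_interval_sum_le_sharp` — **the theorem**: from any Vinogradov–Korobov region there are
  `K, C_r` with, for large `x`, `4 ≤ T ≤ νx`, `e² ≤ Q ≤ exp(√log νx + 1)`, `1 < ν ≤ 2`, block primes `≤ Q`,
  `M = min_{|t| ≤ T} 𝔻(g, n^{it}; νx)²` and `34M + C_r ≤ log log x`:
  `|∑_{x < n ≤ νx, n ∈ 𝒮} g(n)| ≤ K((ν-1)x(e^{-M/2} + 1/T + (|𝓙|+1)√((log Q+2)/log x) + √(log x)/T) + (|𝓙|+1)x(ν-1)^{-1/12}/√(log x) + x/log x + x/T + |E|)`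
  (the new garbage term `(ν-1)x√(log x)/T` is the Poisson tail of the off-block product, which carries `e^{K₀} ≤ 2e⁴√(log νx)`).
  Outside the regime `norm_restr_interval_sum_le` gives `(1 + M/2)e^{-M/2+O(1)} ≤ (log x)^{-1/70}`.

What this is for.  Fed into the Gallagher treatment of the window `|t - t₁| ≤ (log X)^{1/16}` (the tree's
`HalaszRestrictedMultWindow`/`HalaszRestrictedShortMeanSquare` programme) in place of `norm_restr_interval_sum_le`, the
theorem yields the middle term `K e^{-M}` — i.e. `MRT2015.PropA3With (fun M => K e^{-M})`, Proposition A.3 / Theorem A.2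
of Matomäki–Radziwiłł–Tao with the PRINTED (indeed better) middle term, for completely multiplicative `f`.  The named
fact `MatomakiRadziwillTao2015_propA3` (general multiplicative `f`) additionally needs the `𝒯₂`/window machinery for
multiplicative `f`; the argument of this series is new (the printed proof's pointwise step is false for restricted
sums, see the Status section of `MatomakiRadziwillTaoPropA3.lean`).

## References
* A. Granville, K. Soundararajan, *Decay of mean values of multiplicative functions*, Canad. J. Math. 55 (2003),
  Lemma 2.1, §3b, §4 (the `α`-integration). [cite: GranvilleSoundararajan2003, Theorem 1]
* K. Matomäki, M. Radziwiłł, T. Tao, *An averaged form of Chowla's conjecture*, Algebra & Number Theory 9 (2015),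
  Appendix A, Proposition A.3 and its proof (the ranges `𝒯₀ ∪ 𝒯₁`). [cite: MatomakiRadziwillTao2015, Appendix A, Proposition A.3]
* K. Matomäki, M. Radziwiłł, *Multiplicative functions in short intervals II*, arXiv:2007.04290, Lemma 5.3 and the
  Remark after Theorem 9.2. [cite: MatomakiRadziwill2020ShortIntervalsII, Lemma 5.3]

## Design choices
* `θ = 7/10`; the scale `α_m = e^{M/2}/log(νx)`; the break point `α₁ = max(α₀, min(e^{M-d}/log νx, α_m))`.
* Constants existential (`∃ K C_r`, `∀ᶠ x in atTop`, from the `ζ`- and Vinogradov–Korobov constants); the regime is the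
  explicit linear condition `34 M + C_r ≤ log log x`; all other thresholds (`log log νx ≥ 200` etc.) follow from it.
* The bookkeeping of the final theorem is that of `norm_restr_interval_sum_le` (terms t1–t9 against the units
  `ηxℓe^{-M/2}`, `ηxℓ√ℓ/T`, …), split into the lemmas above so that the file elaborates quickly.
-/

noncomputable section

open Finset Real Complex MeasureTheory Filter
open scoped ComplexConjugate

namespace Literature.NumberTheory.LFunctions

namespace Halasz

open MellinPlancherel (psum)

namespace Restricted.Sharp

open Literature.NumberTheory.Sieve (pretentiousDistSq minPretentiousDistSq)

/-! ### The regime `34 M + C_r ≤ log log x`: consequences -/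

/-- **The regime.**  With `ℓ = log x ≤ ℓN = log(νx) ≤ 2ℓ`, `Q ≤ exp(√ℓN + 1)`, `L ≤ √ℓN + 3` and
`34 M + 203 + 4 C ≤ log ℓ`, the scale `α_m = e^{M/2}/ℓN` satisfies all the side conditions of
`norm_LSeries_restr_sharp` at `θ = 7/10`: `α_m ≤ 1`, `exp((log 2νx)^{7/10}) ≤ e^{1/α_m} ≤ νx`,
`Q ≤ exp((log 2νx)^{7/10}) - 1`, the two regime conditions, and `e^{M/2} ≤ √ℓ`, `ℓN ≥ 32`. [folklore] -/
theorem regime_facts {M ℓ ℓN xN Q C L : ℝ} (hM0 : 0 ≤ M) (hℓ1 : 1 < ℓ) (hℓN : ℓ ≤ ℓN)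
    (hxN3 : 3 ≤ xN) (hℓNdef : ℓN = Real.log xN) (hQle : Q ≤ Real.exp (Real.sqrt ℓN + 1)) (hC0 : 0 ≤ C)
    (hregℓ : 34 * M + 203 + 4 * C ≤ Real.log ℓ) (hL0 : 0 ≤ L) (hLle' : L ≤ Real.sqrt ℓN + 3) :
    Real.exp (M / 2) ≤ Real.sqrt ℓ ∧
    Real.exp (M / 2) / ℓN ≤ 1 ∧
    1 / (Real.exp (M / 2) / ℓN) = ℓN * Real.exp (-M / 2) ∧
    Real.exp (1 / (Real.exp (M / 2) / ℓN)) ≤ xN ∧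
    Real.exp (Real.log (2 * xN) ^ (7 / 10 : ℝ)) ≤ Real.exp (1 / (Real.exp (M / 2) / ℓN)) ∧
    Q ≤ Real.exp (Real.log (2 * xN) ^ (7 / 10 : ℝ)) - 1 ∧
    9 * M + 60 + C ≤ Real.log (1 / (Real.exp (M / 2) / ℓN)) - (7 / 10 : ℝ) * Real.log (Real.log (2 * xN)) ∧
    (2 * (Real.exp (M / 2) / ℓN) + Real.exp (9 * M + 60 + C) * (Real.exp (M / 2) / ℓN)) * L ≤ 1 ∧
    32 ≤ ℓN := by
  have hℓ0 : 0 < ℓ := by linarith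
  have hℓN0 : 0 < ℓN := by linarith
  have hℓN1 : 1 ≤ ℓN := by linarith
  have hxN0 : 0 < xN := by linarith
  have hlog2 : Real.log 2 < 1 := by have := Real.log_two_lt_d9; linarith
  have hregN : 34 * M + 203 + 4 * C ≤ Real.log ℓN := by
    have : Real.log ℓ ≤ Real.log ℓN := Real.log_le_log hℓ0 hℓN
    linarith
  have hlogℓN200 : 200 ≤ Real.log ℓN := by linarith
  have hℓNbig : Real.exp 200 ≤ ℓN := by
    rw [← Real.exp_log hℓN0]; exact Real.exp_le_exp.2 hlogℓN200
  have hℓN32 : 32 ≤ ℓN := le_trans (by have := Real.add_one_le_exp (200:ℝ); linarith) hℓNbig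
  have hMlogℓ : M ≤ Real.log ℓ := by linarith
  have hΦ0 : 0 < Real.exp (-M / 2) := Real.exp_pos _
  have hΦ1 : Real.exp (-M / 2) ≤ 1 := by rw [← Real.exp_zero]; exact Real.exp_le_exp.2 (by linarith)
  have hLle : L ≤ 2 * Real.sqrt ℓN := by
    have hs4 : (3 : ℝ) ≤ Real.sqrt ℓN := by
      rw [Real.le_sqrt (by norm_num) hℓN0.le]; linarith
    linarith
  have hℓN243 : 243 ≤ ℓN := by
    refine le_trans ?_ hℓNbig
    have h := Real.add_one_le_exp (100:ℝ)
    have e : Real.exp 200 = Real.exp 100 * Real.exp 100 := by rw [← Real.exp_add]; norm_num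
    rw [e]; nlinarith
  -- `e^{M/2} ≤ √ℓ`, `e^{M/2} · 2 ≤ ℓN^{3/10}`
  have heM2ℓ : Real.exp (M / 2) ≤ Real.sqrt ℓ := by
    rw [← Real.exp_log (Real.sqrt_pos.mpr hℓ0), Real.log_sqrt hℓ0.le]
    exact Real.exp_le_exp.2 (by linarith)
  have hsqrtℓ1 : 1 ≤ Real.sqrt ℓ := by rw [← Real.sqrt_one]; exact Real.sqrt_le_sqrt hℓ1.le
  have hsqrtℓle : Real.sqrt ℓ ≤ ℓ := by
    have h1 : Real.sqrt ℓ * 1 ≤ Real.sqrt ℓ * Real.sqrt ℓ :=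
      mul_le_mul_of_nonneg_left hsqrtℓ1 (Real.sqrt_nonneg ℓ)
    rw [mul_one, Real.mul_self_sqrt hℓ0.le] at h1
    exact h1
  have heM2 : Real.exp (M / 2) ≤ ℓN := heM2ℓ.trans (hsqrtℓle.trans hℓN)
  have heM2pow : 2 * Real.exp (M / 2) ≤ ℓN ^ (3 / 10 : ℝ) := by
    rw [Real.rpow_def_of_pos hℓN0, show Real.log ℓN * (3 / 10 : ℝ) = (3 / 10) * Real.log ℓN by ring]
    have h1 : Real.log 2 + M / 2 ≤ (3 / 10) * Real.log ℓN := by linarith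
    calc 2 * Real.exp (M / 2) = Real.exp (Real.log 2 + M / 2) := by
          rw [Real.exp_add, Real.exp_log (by norm_num)]
      _ ≤ Real.exp ((3 / 10) * Real.log ℓN) := Real.exp_le_exp.2 h1
  set αm : ℝ := Real.exp (M / 2) / ℓN with hαm
  have hαm0 : 0 < αm := by positivity
  have hαm1 : αm ≤ 1 := by rw [hαm, div_le_one hℓN0]; exact heM2
  have hαminv : 1 / αm = ℓN * Real.exp (-M / 2) := by
    rw [hαm, show (-M / 2) = -(M / 2) by ring, Real.exp_neg]
    field_simp
  have hlog2xN : Real.log (2 * xN) ≤ 2 * ℓN := by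
    rw [Real.log_mul (by norm_num) hxN0.ne', ← hℓNdef]; linarith
  have hlog2xN0 : 0 ≤ Real.log (2 * xN) := Real.log_nonneg (by linarith)
  have hlog2xNℓ : ℓN ≤ Real.log (2 * xN) := by rw [hℓNdef]; exact Real.log_le_log hxN0 (by linarith)
  have hpow07 : Real.log (2 * xN) ^ (7 / 10 : ℝ) ≤ 2 * ℓN ^ (7 / 10 : ℝ) := by
    calc Real.log (2 * xN) ^ (7 / 10 : ℝ) ≤ (2 * ℓN) ^ (7 / 10 : ℝ) :=
          Real.rpow_le_rpow hlog2xN0 hlog2xN (by norm_num)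
      _ = (2 : ℝ) ^ (7 / 10 : ℝ) * ℓN ^ (7 / 10 : ℝ) := Real.mul_rpow (by norm_num) hℓN0.le
      _ ≤ 2 * ℓN ^ (7 / 10 : ℝ) := by
          gcongr
          calc (2 : ℝ) ^ (7 / 10 : ℝ) ≤ (2 : ℝ) ^ (1 : ℝ) := Real.rpow_le_rpow_of_exponent_le (by norm_num) (by norm_num)
            _ = 2 := Real.rpow_one 2
  have hsplitℓN : ℓN ^ (7 / 10 : ℝ) * ℓN ^ (3 / 10 : ℝ) = ℓN := by
    rw [← Real.rpow_add hℓN0]; norm_num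
  have hzx : Real.exp (1 / αm) ≤ xN := by
    rw [hαminv]
    calc Real.exp (ℓN * Real.exp (-M / 2)) ≤ Real.exp ℓN := by
          refine Real.exp_le_exp.2 ?_
          have : Real.exp (-M / 2) ≤ 1 := hΦ1
          nlinarith
      _ = xN := by rw [hℓNdef, Real.exp_log hxN0]
  have hwz : Real.exp (Real.log (2 * xN) ^ (7 / 10 : ℝ)) ≤ Real.exp (1 / αm) := by
    refine Real.exp_le_exp.2 ?_
    rw [hαminv]
    -- `(log 2xN)^{0.7} ≤ 2 ℓN^{0.7} ≤ ℓN^{0.7} ℓN^{0.3} e^{-M/2} · ...`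
    have h1 : 2 * ℓN ^ (7 / 10 : ℝ) * Real.exp (M / 2) ≤ ℓN := by
      have h0 : 0 ≤ ℓN ^ (7 / 10 : ℝ) := Real.rpow_nonneg hℓN0.le _
      calc 2 * ℓN ^ (7 / 10 : ℝ) * Real.exp (M / 2) = ℓN ^ (7 / 10 : ℝ) * (2 * Real.exp (M / 2)) := by ring
        _ ≤ ℓN ^ (7 / 10 : ℝ) * ℓN ^ (3 / 10 : ℝ) := mul_le_mul_of_nonneg_left heM2pow h0
        _ = ℓN := hsplitℓN
    have h2 : Real.exp (M / 2) * Real.exp (-M / 2) = 1 := by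
      rw [← Real.exp_add, show M / 2 + -M / 2 = 0 by ring, Real.exp_zero]
    calc Real.log (2 * xN) ^ (7 / 10 : ℝ) ≤ 2 * ℓN ^ (7 / 10 : ℝ) := hpow07
      _ = 2 * ℓN ^ (7 / 10 : ℝ) * Real.exp (M / 2) * Real.exp (-M / 2) := by rw [mul_assoc, h2, mul_one]
      _ ≤ ℓN * Real.exp (-M / 2) := mul_le_mul_of_nonneg_right h1 hΦ0.le
  have hQw : Q ≤ Real.exp (Real.log (2 * xN) ^ (7 / 10 : ℝ)) - 1 := by
    -- `Q ≤ e^{√ℓN}`, `e^{√ℓN} + 1 ≤ e^{√ℓN + 1} ≤ e^{ℓN^{0.7}} ≤ e^{(log 2xN)^{0.7}}`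
    have hs0 : 0 ≤ Real.sqrt ℓN := Real.sqrt_nonneg _
    have h1' : Real.exp (Real.sqrt ℓN + 1) + 1 ≤ Real.exp (Real.sqrt ℓN + 1 + 1) :=
      Sharp.exp_add_one_le_exp_add_one (by linarith)
    have h2 : Real.sqrt ℓN + 1 + 1 ≤ ℓN ^ (7 / 10 : ℝ) := by
      -- `ℓN^{0.7} = ℓN^{0.5} ℓN^{0.2}` and `ℓN^{0.2} ≥ 3`
      have hs : Real.sqrt ℓN = ℓN ^ (1 / 2 : ℝ) := Real.sqrt_eq_rpow ℓN
      have h03 : (3 : ℝ) ≤ ℓN ^ (1 / 5 : ℝ) := by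
        have : (243 : ℝ) ^ (1 / 5 : ℝ) = 3 := by
          rw [show (243 : ℝ) = 3 ^ (5 : ℝ) by norm_num, ← Real.rpow_mul (by norm_num)]; norm_num
        rw [← this]
        exact Real.rpow_le_rpow (by norm_num) hℓN243 (by norm_num)
      have hsplit : ℓN ^ (7 / 10 : ℝ) = ℓN ^ (1 / 2 : ℝ) * ℓN ^ (1 / 5 : ℝ) := by
        rw [← Real.rpow_add hℓN0]; norm_num
      have hs1 : 1 ≤ Real.sqrt ℓN := by rw [← Real.sqrt_one]; exact Real.sqrt_le_sqrt hℓN1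
      rw [hsplit, ← hs]
      calc Real.sqrt ℓN + 1 + 1 ≤ Real.sqrt ℓN + Real.sqrt ℓN + Real.sqrt ℓN := by linarith
        _ = Real.sqrt ℓN * 3 := by ring
        _ ≤ Real.sqrt ℓN * ℓN ^ (1 / 5 : ℝ) := mul_le_mul_of_nonneg_left h03 hs0
    calc Q ≤ Real.exp (Real.sqrt ℓN + 1) := hQle
      _ ≤ Real.exp (Real.sqrt ℓN + 1 + 1) - 1 := by linarith
      _ ≤ Real.exp (Real.log (2 * xN) ^ (7 / 10 : ℝ)) - 1 := by
          gcongr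
          exact h2.trans (Real.rpow_le_rpow hℓN0.le hlog2xNℓ (by norm_num))
  -- the two regime conditions of the sharp bound
  have hreg : 9 * M + 60 + C ≤ Real.log (1 / αm) - (7 / 10 : ℝ) * Real.log (Real.log (2 * xN)) := by
    have h1 : Real.log (1 / αm) = Real.log ℓN - M / 2 := by
      rw [hαminv, Real.log_mul hℓN0.ne' (Real.exp_pos _).ne', Real.log_exp]; ring
    have h2 : Real.log (Real.log (2 * xN)) ≤ 1 + Real.log ℓN := by
      calc Real.log (Real.log (2 * xN)) ≤ Real.log (2 * ℓN) := Real.log_le_log (by linarith) hlog2xN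
        _ = Real.log 2 + Real.log ℓN := Real.log_mul (by norm_num) hℓN0.ne'
        _ ≤ 1 + Real.log ℓN := by linarith
    rw [h1]
    nlinarith
  have hfr : (2 * αm + Real.exp (9 * M + 60 + C) * αm) * L ≤ 1 := by
    -- `(2 + e^c) e^{M/2} L ≤ 3 e^c e^{M/2} · 2√ℓN ≤ ℓN` iff `6 e^{c + M/2} ≤ √ℓN`
    have hc0 : 1 ≤ Real.exp (9 * M + 60 + C) := by
      rw [← Real.exp_zero]; exact Real.exp_le_exp.2 (by positivity)
    have hkey : 6 * Real.exp (9 * M + 60 + C + M / 2) ≤ Real.sqrt ℓN := by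
      rw [← Real.exp_log (Real.sqrt_pos.mpr hℓN0), Real.log_sqrt hℓN0.le]
      have h6 : (6 : ℝ) ≤ Real.exp 2 := by
        have h1 : (2.7 : ℝ) ≤ Real.exp 1 := by have := Real.exp_one_gt_d9; linarith
        have h2 : Real.exp 2 = Real.exp 1 * Real.exp 1 := by rw [← Real.exp_add]; norm_num
        rw [h2]
        calc (6 : ℝ) ≤ 2.7 * 2.7 := by norm_num
          _ ≤ Real.exp 1 * Real.exp 1 := mul_le_mul h1 h1 (by norm_num) (Real.exp_pos 1).le
      calc 6 * Real.exp (9 * M + 60 + C + M / 2) ≤ Real.exp 2 * Real.exp (9 * M + 60 + C + M / 2) := by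
            gcongr
        _ = Real.exp (2 + (9 * M + 60 + C + M / 2)) := (Real.exp_add _ _).symm
        _ ≤ Real.exp (Real.log ℓN / 2) := Real.exp_le_exp.2 (by linarith)
    have hexpsplit : Real.exp (9 * M + 60 + C + M / 2) = Real.exp (9 * M + 60 + C) * Real.exp (M / 2) :=
      Real.exp_add _ _
    have hsq : Real.sqrt ℓN * Real.sqrt ℓN = ℓN := Real.mul_self_sqrt hℓN0.le
    have hs0 : 0 ≤ Real.sqrt ℓN := Real.sqrt_nonneg _
    rw [hαm]
    rw [show (2 * (Real.exp (M / 2) / ℓN) + Real.exp (9 * M + 60 + C) * (Real.exp (M / 2) / ℓN)) * L =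
      ((2 + Real.exp (9 * M + 60 + C)) * Real.exp (M / 2) * L) / ℓN by ring]
    rw [div_le_one hℓN0]
    calc (2 + Real.exp (9 * M + 60 + C)) * Real.exp (M / 2) * L
        ≤ (3 * Real.exp (9 * M + 60 + C)) * Real.exp (M / 2) * (2 * Real.sqrt ℓN) := by
          gcongr
          linarith
      _ = (6 * Real.exp (9 * M + 60 + C + M / 2)) * Real.sqrt ℓN := by rw [hexpsplit]; ring
      _ ≤ Real.sqrt ℓN * Real.sqrt ℓN := mul_le_mul_of_nonneg_right hkey hs0
      _ = ℓN := hsq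
  exact ⟨heM2ℓ, hαm1, hαminv, hzx, hwz, hQw, hreg, hfr, hℓN32⟩

/-! ### The two real inequalities behind the three regimes -/

/-- With `α₀ = 1/(2ℓ)`, `α_c = e^{M-d}/ℓN`, `α_m = e^{M/2}/ℓN`, `α₁ = max(α₀, min(α_c, α_m))` (`0 < ℓ ≤ ℓN`):
`e^{-d/2} e^{-(M-d)} log(α₁/α₀) ≤ 2 e^{-M/2}` (since `log(α₁/α₀) ≤ max(0, M - d + log 2)` and
`(v + 1) e^{-v/2} ≤ 2`). [folklore] -/
theorem key_log_ineq {M d ℓ ℓN : ℝ} (hℓ0 : 0 < ℓ) (hℓN : ℓ ≤ ℓN) :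
    Real.exp (-d / 2) * Real.exp (-(M - d)) *
        Real.log (max (1 / (2 * ℓ)) (min (Real.exp (M - d) / ℓN) (Real.exp (M / 2) / ℓN)) / (1 / (2 * ℓ))) ≤
      2 * Real.exp (-M / 2) := by
  have hℓN0 : 0 < ℓN := by linarith
  have hlog2 : Real.log 2 < 1 := by have := Real.log_two_lt_d9; linarith
  set α₀ : ℝ := 1 / (2 * ℓ) with hα₀
  set αc : ℝ := Real.exp (M - d) / ℓN with hαc
  set αm : ℝ := Real.exp (M / 2) / ℓN with hαm
  set α₁ : ℝ := max α₀ (min αc αm) with hα₁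
  set Φ : ℝ := Real.exp (-M / 2) with hΦ
  have hα₀0 : 0 < α₀ := by positivity
  have hΦ0 : 0 < Φ := Real.exp_pos _
  have h01 : α₀ ≤ α₁ := le_max_left _ _
  have hq0 : 0 < α₁ / α₀ := div_pos (hα₀0.trans_le h01) hα₀0
  -- `log(α₁/α₀) ≤ max 0 (M - d + log 2)`
  have hα₁le : α₁ ≤ max α₀ αc := max_le_max le_rfl (min_le_left _ _)
  have hαcα₀ : αc ≤ 2 * Real.exp (M - d) * α₀ := by
    rw [hαc, hα₀]
    calc Real.exp (M - d) / ℓN ≤ Real.exp (M - d) / ℓ := div_le_div_of_nonneg_left (Real.exp_pos _).le hℓ0 hℓN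
      _ = 2 * Real.exp (M - d) * (1 / (2 * ℓ)) := by ring
  have hratio : α₁ / α₀ ≤ max 1 (2 * Real.exp (M - d)) := by
    rw [div_le_iff₀ hα₀0]
    rcases le_total α₀ αc with hc | hc
    · calc α₁ ≤ αc := hα₁le.trans (max_le hc le_rfl)
        _ ≤ 2 * Real.exp (M - d) * α₀ := hαcα₀
        _ ≤ max 1 (2 * Real.exp (M - d)) * α₀ := mul_le_mul_of_nonneg_right (le_max_right _ _) hα₀0.le
    · calc α₁ ≤ α₀ := hα₁le.trans (max_le le_rfl hc)
        _ = 1 * α₀ := (one_mul _).symm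
        _ ≤ max 1 (2 * Real.exp (M - d)) * α₀ := mul_le_mul_of_nonneg_right (le_max_left _ _) hα₀0.le
  have hlogle : Real.log (α₁ / α₀) ≤ max 0 (M - d + Real.log 2) := by
    rcases le_total 1 (2 * Real.exp (M - d)) with h1 | h1
    · rw [max_eq_right h1] at hratio
      calc Real.log (α₁ / α₀) ≤ Real.log (2 * Real.exp (M - d)) := Real.log_le_log hq0 hratio
        _ = M - d + Real.log 2 := by rw [Real.log_mul (by norm_num) (Real.exp_pos _).ne', Real.log_exp]; ring
        _ ≤ max 0 (M - d + Real.log 2) := le_max_right _ _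
    · rw [max_eq_left h1] at hratio
      calc Real.log (α₁ / α₀) ≤ Real.log 1 := Real.log_le_log hq0 hratio
        _ = 0 := Real.log_one
        _ ≤ max 0 (M - d + Real.log 2) := le_max_left _ _
  have hfac : Real.exp (-d / 2) * Real.exp (-(M - d)) = Φ * Real.exp (-(M - d) / 2) := by
    rw [hΦ, ← Real.exp_add, ← Real.exp_add]
    congr 1; ring
  rw [hfac, mul_assoc, mul_comm 2 Φ]
  refine mul_le_mul_of_nonneg_left ?_ hΦ0.le
  rcases le_or_gt (M - d + Real.log 2) 0 with hneg | hpos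
  · rw [max_eq_left hneg] at hlogle
    have : Real.exp (-(M - d) / 2) * Real.log (α₁ / α₀) ≤ 0 :=
      mul_nonpos_of_nonneg_of_nonpos (Real.exp_pos _).le hlogle
    linarith
  · rw [max_eq_right hpos.le] at hlogle
    have h1 : Real.log (α₁ / α₀) ≤ M - d + 1 := by linarith
    have h2 := Sharp.add_one_mul_exp_neg_half_le_two (M - d)
    calc Real.exp (-(M - d) / 2) * Real.log (α₁ / α₀) ≤ Real.exp (-(M - d) / 2) * (M - d + 1) :=
          mul_le_mul_of_nonneg_left h1 (Real.exp_pos _).le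
      _ = (M - d + 1) * Real.exp (-(M - d) / 2) := by ring
      _ ≤ 2 := h2

/-- Same setting: `e^{-d/2}/α₁ ≤ 2 ℓN e^{-M/2}` (`d ≥ 0`). [folklore] -/
theorem key_inv_ineq {M d ℓ ℓN : ℝ} (hd0 : 0 ≤ d) (hℓ0 : 0 < ℓ) (hℓN : ℓ ≤ ℓN) :
    Real.exp (-d / 2) / max (1 / (2 * ℓ)) (min (Real.exp (M - d) / ℓN) (Real.exp (M / 2) / ℓN)) ≤
      2 * ℓN * Real.exp (-M / 2) := by
  have hℓN0 : 0 < ℓN := by linarith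
  set α₀ : ℝ := 1 / (2 * ℓ) with hα₀
  set αc : ℝ := Real.exp (M - d) / ℓN with hαc
  set αm : ℝ := Real.exp (M / 2) / ℓN with hαm
  set α₁ : ℝ := max α₀ (min αc αm) with hα₁
  set Φ : ℝ := Real.exp (-M / 2) with hΦ
  have hα₀0 : 0 < α₀ := by positivity
  have hαc0 : 0 < αc := by positivity
  have hαm0 : 0 < αm := by positivity
  have hΦ0 : 0 < Φ := Real.exp_pos _
  have h01 : α₀ ≤ α₁ := le_max_left _ _
  have hα₁min : min αc αm ≤ α₁ := le_max_right _ _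
  have hαminv : 1 / αm = ℓN * Real.exp (-M / 2) := by
    rw [hαm, show (-M / 2) = -(M / 2) by ring, Real.exp_neg]
    field_simp
  rcases le_or_gt d M with hdM | hdM
  · -- `1/α₁ ≤ 1/min(αc, αm)`
    have hinv : 1 / α₁ ≤ 1 / min αc αm := one_div_le_one_div_of_le (lt_min hαc0 hαm0) hα₁min
    rw [div_eq_mul_one_div]
    have hed0 : 0 ≤ Real.exp (-d / 2) := (Real.exp_pos _).le
    refine (mul_le_mul_of_nonneg_left hinv hed0).trans ?_
    rcases le_total αc αm with hc2 | hc2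
    · rw [min_eq_left hc2, hαc, one_div_div]
      -- `e^{-d/2} ℓN e^{-(M-d)} = ℓN Φ e^{-(M-d)/2} ≤ ℓN Φ`
      have hfac : Real.exp (-d / 2) * (ℓN / Real.exp (M - d)) = ℓN * Φ * Real.exp (-(M - d) / 2) := by
        rw [hΦ, show ℓN / Real.exp (M - d) = ℓN * Real.exp (-(M - d)) by rw [Real.exp_neg, div_eq_mul_inv]]
        have e : -d / 2 + -(M - d) = -M / 2 + -(M - d) / 2 := by ring
        calc Real.exp (-d / 2) * (ℓN * Real.exp (-(M - d))) = ℓN * (Real.exp (-d / 2) * Real.exp (-(M - d))) := by ring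
          _ = ℓN * Real.exp (-d / 2 + -(M - d)) := by rw [← Real.exp_add]
          _ = ℓN * Real.exp (-M / 2 + -(M - d) / 2) := by rw [e]
          _ = ℓN * (Real.exp (-M / 2) * Real.exp (-(M - d) / 2)) := by rw [Real.exp_add]
          _ = ℓN * Real.exp (-M / 2) * Real.exp (-(M - d) / 2) := by ring
      rw [hfac]
      have h1 : Real.exp (-(M - d) / 2) ≤ 1 := by
        rw [← Real.exp_zero]; exact Real.exp_le_exp.2 (by linarith)
      have h0 : 0 ≤ ℓN * Φ := by positivity
      calc ℓN * Φ * Real.exp (-(M - d) / 2) ≤ ℓN * Φ * 1 := mul_le_mul_of_nonneg_left h1 h0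
        _ ≤ 2 * ℓN * Φ := by linarith
    · rw [min_eq_right hc2, hαminv]
      have h1 : Real.exp (-d / 2) ≤ 1 := by rw [← Real.exp_zero]; exact Real.exp_le_exp.2 (by linarith)
      have h0 : 0 ≤ ℓN * Real.exp (-M / 2) := by positivity
      rw [hΦ]
      calc Real.exp (-d / 2) * (ℓN * Real.exp (-M / 2)) ≤ 1 * (ℓN * Real.exp (-M / 2)) :=
            mul_le_mul_of_nonneg_right h1 h0
        _ ≤ 2 * ℓN * Real.exp (-M / 2) := by linarith
  · -- `d > M`: `1/α₁ ≤ 1/α₀ = 2ℓ` and `e^{-d/2} ≤ Φ`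
    have hinv : 1 / α₁ ≤ 2 * ℓ := by
      calc 1 / α₁ ≤ 1 / α₀ := one_div_le_one_div_of_le hα₀0 h01
        _ = 2 * ℓ := by rw [hα₀, one_div_one_div]
    have hed : Real.exp (-d / 2) ≤ Φ := by rw [hΦ]; exact Real.exp_le_exp.2 (by linarith)
    rw [div_eq_mul_one_div]
    calc Real.exp (-d / 2) * (1 / α₁) ≤ Φ * (2 * ℓ) :=
          mul_le_mul hed hinv (by positivity) hΦ0.le
      _ ≤ Φ * (2 * ℓN) := by gcongr
      _ = 2 * ℓN * Φ := by ring

/-! ### The `F`-term of the mean square (verbatim estimate of the tree, isolated) -/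

/-- The estimate "t5" of `norm_restr_interval_sum_le`:
`17 x · 2F√(2ℓ) ≤ 49 √(272 K_C) e^{12} (m+1) x η^{-1/12} √ℓ + 140 e^{12} η x m ρ ℓ`, where
`F = e^{12}(√G + m √(8η² log Q + G))`, `G ≤ 272 K_C η^{-1/6}`, `ρ = √((log Q + 2)/ℓ)`. [folklore] -/
theorem F_term_le {KC η m x ℓ Q G : ℝ} (hKC1 : 1 ≤ KC) (hη0 : 0 < η) (hm0 : 0 ≤ m) (hx0 : 0 < x)
    (hℓ0 : 0 < ℓ) (hlogQ0 : 0 ≤ Real.log Q) (hG0 : 0 ≤ G) (hGle : G ≤ 272 * KC * η ^ (-(1 / 6 : ℝ))) :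
    17 * (2 * (Real.exp 12 * (Real.sqrt G + m * Real.sqrt (8 * η ^ 2 * Real.log Q + G))) * Real.sqrt (2 * ℓ)) * x ≤
      49 * Real.sqrt (272 * KC) * Real.exp 12 * ((m + 1) * x * η ^ (-(1 / 12 : ℝ)) * Real.sqrt ℓ) +
        140 * Real.exp 12 * (η * x * m * (Real.sqrt ((Real.log Q + 2) / ℓ) * ℓ)) := by
  set e12 : ℝ := Real.exp 12 with he12
  set cG : ℝ := Real.sqrt (272 * KC) with hcG
  set ρ : ℝ := Real.sqrt ((Real.log Q + 2) / ℓ) with hρ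
  set F : ℝ := e12 * (Real.sqrt G + m * Real.sqrt (8 * η ^ 2 * Real.log Q + G)) with hF
  have he12pos : 0 < e12 := Real.exp_pos _
  have hcG0 : 0 ≤ cG := Real.sqrt_nonneg _
  have hρ0 : 0 ≤ ρ := Real.sqrt_nonneg _
  have hs2 : Real.sqrt 2 ≤ 1.42 := by
    rw [Real.sqrt_le_left (by norm_num)]; norm_num
  have hs8 : Real.sqrt 8 ≤ 2.83 := by
    rw [Real.sqrt_le_left (by norm_num)]; norm_num
  have hsplit : Real.sqrt (2 * ℓ) = Real.sqrt 2 * Real.sqrt ℓ := Real.sqrt_mul (by norm_num) ℓ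
  have hsl0 : 0 < Real.sqrt ℓ := Real.sqrt_pos.mpr hℓ0
  have hsqrtG : Real.sqrt G ≤ cG * η ^ (-(1 / 12 : ℝ)) := by
    have e1 : η ^ (-(1 / 6 : ℝ)) = (η ^ (-(1 / 12 : ℝ))) ^ 2 := by
      rw [← Real.rpow_natCast, ← Real.rpow_mul hη0.le]; norm_num
    have hpos : 0 ≤ η ^ (-(1 / 12 : ℝ)) := Real.rpow_nonneg hη0.le _
    calc Real.sqrt G ≤ Real.sqrt (272 * KC * η ^ (-(1 / 6 : ℝ))) := Real.sqrt_le_sqrt hGle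
      _ = cG * η ^ (-(1 / 12 : ℝ)) := by
          rw [e1, Real.sqrt_mul (by positivity), Real.sqrt_sq hpos, hcG]
  have hsqrtW : Real.sqrt (8 * η ^ 2 * Real.log Q + G) ≤ 2.83 * η * Real.sqrt (Real.log Q + 2) + Real.sqrt G := by
    have h1 : Real.sqrt (8 * η ^ 2 * Real.log Q + G) ≤ Real.sqrt (8 * η ^ 2 * Real.log Q) + Real.sqrt G :=
      sqrt_add_le' (mul_nonneg (by positivity) hlogQ0) hG0
    have h2 : Real.sqrt (8 * η ^ 2 * Real.log Q) ≤ 2.83 * η * Real.sqrt (Real.log Q + 2) := by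
      rw [show 8 * η ^ 2 * Real.log Q = (8 * η ^ 2) * Real.log Q by ring,
        Real.sqrt_mul (by positivity), Real.sqrt_mul (by norm_num), Real.sqrt_sq hη0.le]
      have : Real.sqrt (Real.log Q) ≤ Real.sqrt (Real.log Q + 2) := Real.sqrt_le_sqrt (by linarith)
      have h3 : Real.sqrt 8 * η * Real.sqrt (Real.log Q) ≤ 2.83 * η * Real.sqrt (Real.log Q + 2) :=
        mul_le_mul (mul_le_mul_of_nonneg_right hs8 hη0.le) this (Real.sqrt_nonneg _) (by positivity)
      linarith only [h3]
    linarith only [h1, h2]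
  have hρℓ : Real.sqrt (Real.log Q + 2) * Real.sqrt ℓ = ρ * ℓ := by
    rw [hρ, Real.sqrt_div' _ hℓ0.le, div_mul_eq_mul_div, eq_div_iff hsl0.ne']
    calc Real.sqrt (Real.log Q + 2) * Real.sqrt ℓ * Real.sqrt ℓ
        = Real.sqrt (Real.log Q + 2) * (Real.sqrt ℓ * Real.sqrt ℓ) := by ring
      _ = Real.sqrt (Real.log Q + 2) * ℓ := by rw [Real.mul_self_sqrt hℓ0.le]
  have hFle : F ≤ e12 * ((m + 1) * (cG * η ^ (-(1 / 12 : ℝ))) + 2.83 * m * η * Real.sqrt (Real.log Q + 2)) := by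
    rw [hF]
    refine mul_le_mul_of_nonneg_left ?_ he12pos.le
    have h1 : m * Real.sqrt (8 * η ^ 2 * Real.log Q + G) ≤ m * (2.83 * η * Real.sqrt (Real.log Q + 2) + Real.sqrt G) :=
      mul_le_mul_of_nonneg_left hsqrtW hm0
    have h2 := mul_le_mul_of_nonneg_left hsqrtG hm0
    linarith only [hsqrtG, h1, h2]
  calc 17 * (2 * F * Real.sqrt (2 * ℓ)) * x = 34 * x * F * (Real.sqrt 2 * Real.sqrt ℓ) := by rw [hsplit]; ring
    _ ≤ 34 * x * (e12 * ((m + 1) * (cG * η ^ (-(1 / 12 : ℝ))) + 2.83 * m * η * Real.sqrt (Real.log Q + 2))) *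
          (1.42 * Real.sqrt ℓ) := by
        have hb0 : 0 ≤ 34 * x * (e12 * ((m + 1) * (cG * η ^ (-(1 / 12 : ℝ))) +
            2.83 * m * η * Real.sqrt (Real.log Q + 2))) := by
          refine mul_nonneg (by positivity) (mul_nonneg he12pos.le (add_nonneg ?_ ?_))
          · exact mul_nonneg (by linarith) (mul_nonneg hcG0 (Real.rpow_nonneg hη0.le _))
          · exact mul_nonneg (mul_nonneg (mul_nonneg (by norm_num) hm0) hη0.le) (Real.sqrt_nonneg _)
        refine mul_le_mul (mul_le_mul_of_nonneg_left hFle (by positivity))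
          (mul_le_mul_of_nonneg_right hs2 (Real.sqrt_nonneg ℓ)) (by positivity) hb0
    _ = 34 * 1.42 * e12 * cG * ((m + 1) * x * η ^ (-(1 / 12 : ℝ)) * Real.sqrt ℓ) +
          34 * 1.42 * 2.83 * e12 * (η * x * m * (Real.sqrt (Real.log Q + 2) * Real.sqrt ℓ)) := by ring
    _ ≤ 49 * cG * e12 * ((m + 1) * x * η ^ (-(1 / 12 : ℝ)) * Real.sqrt ℓ) + 140 * e12 * (η * x * m * (ρ * ℓ)) := by
        rw [hρℓ]
        have hA0 : 0 ≤ cG * e12 * ((m + 1) * x * η ^ (-(1 / 12 : ℝ)) * Real.sqrt ℓ) :=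
          mul_nonneg (mul_nonneg hcG0 he12pos.le) (mul_nonneg (mul_nonneg (mul_nonneg (by linarith) hx0.le)
            (Real.rpow_nonneg hη0.le _)) (Real.sqrt_nonneg ℓ))
        have hB0 : 0 ≤ e12 * (η * x * m * (ρ * ℓ)) :=
          mul_nonneg he12pos.le (mul_nonneg (mul_nonneg (mul_nonneg hη0.le hx0.le) hm0) (mul_nonneg hρ0 hℓ0.le))
        linarith only [hA0, hB0]

end Restricted.Sharp

namespace Restricted

open Literature.NumberTheory.Sieve (pretentiousDistSq minPretentiousDistSq)

set_option maxHeartbeats 1600000 in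
/-- **From a per-`α` profile to the `α`-integral.**  In the setting of `inner_integral_restr_interval_le` (block
system at level `⌊x_N⌋`, `x_N ≥ 3`, window `(x, νx]` with `1 < ν ≤ 2`, prime number theorem constant `C`,
`T ≥ 2`, block primes `≤ Q`, `Q ≥ e²`), suppose the restricted series obeys, for `0 < α ≤ α_m` and `|y| ≤ T/2`,
`‖𝒢_a(1+α+iy)‖ ≤ c₁/α + c₂ min(c₃, 1/α) + c₄ α` (nonnegative constants), and let `0 < α₀ ≤ α₁ ≤ α_m ≤ 1`.
Then the `α`-integral `∫_{α₀}^1 I(α) dα` of Granville–Soundararajan's representation is at most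
`2(ν-1)c₂c₃ log(α₁/α₀) + 2(ν-1)c₄ + (2(ν-1)c₁ + 94e⁵/T)/α₀ + (2(ν-1)(c₁+c₂) + 94e⁵/T)/α₁ + (2(ν-1)e^{12} + 94e⁵/T)/α_m`
`+ 2F/√α₀ + 2G_h` (the three regimes `min ≤ c₃`, `min ≤ 1/α`, and the crude `e^{12}/α` beyond `α_m`;
`F, G_h` the extra terms of `inner_integral_restr_interval_le`). [cite: GranvilleSoundararajan2003, §4] -/
theorem integral_profile_le {ι : Type*} [DecidableEq ι] {𝓙 : Finset ι} {blk : ι → Finset ℕ} {g : ℕ → ℂ}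
    {xN x C T Q ν α₀ α₁ αm c₁ c₂ c₃ c₄ : ℝ}
    (hsys : IsBlockSystem 𝓙 blk ⌊xN⌋₊) (hg : ∀ m n, g (m * n) = g m * g n) (hg1 : g 1 = 1)
    (hgb : ∀ n, ‖g n‖ ≤ 1) (hxN3 : 3 ≤ xN) (hx1 : 1 ≤ x) (hC0 : 0 ≤ C)
    (hC : ∀ z : ℝ, 2 ≤ z → |Chebyshev.theta z - z| ≤ C * z / Real.log z ^ (6 : ℝ))
    (hT21 : 1 ≤ T / 2) (hQ : Real.exp 2 ≤ Q) (hblkQ : ∀ i ∈ 𝓙, ∀ p ∈ blk i, (p : ℝ) ≤ Q)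
    (hν : 1 < ν) (hν2 : ν ≤ 2) (hα₀0 : 0 < α₀) (h01 : α₀ ≤ α₁) (h12 : α₁ ≤ αm) (h2 : αm ≤ 1)
    (hc₁ : 0 ≤ c₁) (hc₂ : 0 ≤ c₂) (hc₃ : 0 ≤ c₃) (hc₄ : 0 ≤ c₄)
    (hsharpB : ∀ α : ℝ, 0 < α → α ≤ αm → ∀ y : ℝ, |y| ≤ T / 2 →
      ‖LSeries (restr 𝓙 blk g ⌊xN⌋₊) (1 + α + y * I)‖ ≤ c₁ / α + c₂ * min c₃ (1 / α) + c₄ * α) :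
    ∫ α in Set.Ioc α₀ 1, (∫ u in Set.Ioc (Real.log 2) (Real.log x),
        ‖psum (mulLog (restr 𝓙 blk g ⌊xN⌋₊) ⌊xN⌋₊) (ν * Real.exp u) -
            psum (mulLog (restr 𝓙 blk g ⌊xN⌋₊) ⌊xN⌋₊) (Real.exp u)‖ * Real.exp (-((1 + 2 * α) * u))) ≤
      2 * (ν - 1) * (c₂ * c₃) * Real.log (α₁ / α₀) + 2 * (ν - 1) * c₄ +
        (2 * (ν - 1) * c₁ + 94 * Real.exp 5 / T) / α₀ + (2 * (ν - 1) * (c₁ + c₂) + 94 * Real.exp 5 / T) / α₁ +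
        (2 * (ν - 1) * Real.exp 12 + 94 * Real.exp 5 / T) / αm +
        (2 * (Real.exp 12 * (Real.sqrt (16 * uPNT C ν + 256) +
            𝓙.card * Real.sqrt (8 * (ν - 1) ^ 2 * Real.log Q + (16 * uPNT C ν + 256)))) / Real.sqrt α₀ +
          2 * (32 / Real.sqrt (T / 2) + 90 / (T / 2))) := by
  set N : ℕ := ⌊xN⌋₊ with hN
  set a := restr 𝓙 blk g N with ha_def
  have hab : ∀ n, ‖a n‖ ≤ 1 := norm_restr_le_one hgb
  set η : ℝ := ν - 1 with hη
  set m : ℝ := (𝓙.card : ℝ) with hm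
  set e5 : ℝ := Real.exp 5 with he5
  set e12 : ℝ := Real.exp 12 with he12
  have hη0 : 0 < η := by rw [hη]; linarith
  have hm0 : 0 ≤ m := Nat.cast_nonneg _
  have he5pos : 0 < e5 := Real.exp_pos _
  have he12pos : 0 < e12 := Real.exp_pos _
  have hT0 : 0 < T := by linarith
  have hα₀1 : α₀ ≤ 1 := h01.trans (h12.trans h2)
  have hα₁0 : 0 < α₁ := hα₀0.trans_le h01
  have hαm0 : 0 < αm := hα₁0.trans_le h12
  set Iα : ℝ → ℝ := fun α => ∫ u in Set.Ioc (Real.log 2) (Real.log x),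
    ‖psum (mulLog a N) (ν * Real.exp u) - psum (mulLog a N) (Real.exp u)‖ * Real.exp (-((1 + 2 * α) * u)) with hI
  have hIint : IntegrableOn Iα (Set.Ioc α₀ 1) :=
    (integrable_kernelSh hab N (x := x) hx1 hα₀0.le hν.le hν2).integral_prod_left
  -- the extra terms
  set G : ℝ := 16 * uPNT C ν + 256 with hG
  have hu₁1 : 1 ≤ uPNT C ν := one_le_uPNT hC0 hν
  have hG0 : 0 ≤ G := by rw [hG]; linarith
  set F : ℝ := e12 * (Real.sqrt G + m * Real.sqrt (8 * η ^ 2 * Real.log Q + G)) with hF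
  set Gh : ℝ := 32 / Real.sqrt (T / 2) + 90 / (T / 2) with hGh
  have hF0 : 0 ≤ F := mul_nonneg he12pos.le
    (add_nonneg (Real.sqrt_nonneg G) (mul_nonneg hm0 (Real.sqrt_nonneg _)))
  have hGh0 : 0 ≤ Gh := by positivity
  set X : ℝ → ℝ := fun α => F / (α * Real.sqrt α) + Gh / Real.sqrt α with hX
  obtain ⟨hXint, hXle⟩ := setIntegral_extra_le (F := F) (G := Gh) hα₀0 hα₀1 hF0 hGh0
  -- the crude bound
  have hcrude : ∀ {α : ℝ}, 0 < α → α ≤ 1 → ∀ y : ℝ, ‖LSeries a (1 + α + y * I)‖ ≤ e12 / α := by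
    intro α hα0' hα1' y
    refine (norm_LSeries_restr_le_min hsys hg hg1 hgb hxN3 hα0' hα1' y).trans ?_
    rw [he12]
    calc Real.exp 12 * min (Real.log xN) (1 / α) ≤ Real.exp 12 * (1 / α) := by
          gcongr; exact min_le_right _ _
      _ = Real.exp 12 / α := by ring
  -- constants of the profile
  set P : ℝ := 2 * η * (c₂ * c₃) with hP
  set cc : ℝ := 2 * η * c₄ with hcc
  set E₁ : ℝ := 2 * η * c₁ + 94 * e5 / T with hE₁
  set Q' : ℝ := 2 * η * (c₁ + c₂) + 94 * e5 / T with hQ'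
  set Qc : ℝ := 2 * η * e12 + 94 * e5 / T with hQc
  have hcc0 : 0 ≤ cc := by positivity
  have hE₁0 : 0 ≤ E₁ := by positivity
  have hQ'0 : 0 ≤ Q' := by positivity
  have hQc0 : 0 ≤ Qc := by positivity
  -- the per-`α` bound on `[α₀, α_m]`
  have hper : ∀ {α : ℝ}, α₀ ≤ α → α ≤ αm →
      Iα α - X α ≤ 2 * η * (c₁ / α + c₂ * min c₃ (1 / α) + c₄ * α) / α + (94 * e5 / T) / α ^ 2 := by
    intro α hα0 hα2
    have hα0' : 0 < α := hα₀0.trans_le hα0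
    have hα1' : α ≤ 1 := hα2.trans h2
    set B : ℝ := min (e12 / α) (c₁ / α + c₂ * min c₃ (1 / α) + c₄ * α) with hBdef
    have hmin0 : 0 ≤ min c₃ (1 / α) := le_min hc₃ (by positivity)
    have hB0 : 0 ≤ B := le_min (by positivity) (by positivity)
    have hBle : B ≤ Real.exp 12 / α := by rw [hBdef, he12]; exact min_le_left _ _
    have hBwin : ∀ y : ℝ, |y| ≤ T / 2 → ‖LSeries a (1 + α + y * I)‖ ≤ B := fun y hy =>
      le_min (hcrude hα0' hα1' y) (hsharpB α hα0' hα2 y hy)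
    have hB := inner_integral_restr_interval_le hsys hg hg1 hgb hxN3 hx1 hC0 hC hα0' hα1' hT21 hQ hblkQ
      hν hν2 hB0 hBle hBwin
    have hXα : X α = e12 * (Real.sqrt G + m * Real.sqrt (8 * η ^ 2 * Real.log Q + G)) / (α * Real.sqrt α) +
        (32 / Real.sqrt (T / 2) + 90 / (T / 2)) / Real.sqrt α := by
      simp only [hX, hF, hGh]
    have hmain : 2 * (ν - 1) * B / α ≤ 2 * η * (c₁ / α + c₂ * min c₃ (1 / α) + c₄ * α) / α := by
      rw [hη]
      refine div_le_div_of_nonneg_right (mul_le_mul_of_nonneg_left (min_le_right _ _) (by linarith only [hν])) hα0'.le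
    have htail : 47 * Real.exp 5 / (α ^ 2 * (T / 2)) = (94 * e5 / T) / α ^ 2 := by
      rw [he5]; field_simp; ring
    simp only [hI]
    rw [hm, hη, hG, he12] at hXα
    linarith only [hB, hXα, hmain, htail]
  have hb1 : ∀ α ∈ Set.Icc α₀ α₁, Iα α - X α ≤ P / α + cc + E₁ / α ^ 2 := by
    intro α hα
    have hα0' : 0 < α := hα₀0.trans_le hα.1
    have h := hper hα.1 (hα.2.trans h12)
    have hmin : min c₃ (1 / α) ≤ c₃ := min_le_left _ _
    have hmono : 2 * η * (c₁ / α + c₂ * min c₃ (1 / α) + c₄ * α) / α ≤ 2 * η * (c₁ / α + c₂ * c₃ + c₄ * α) / α := by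
      gcongr
    have e : 2 * η * (c₁ / α + c₂ * c₃ + c₄ * α) / α = P / α + cc + (2 * η * c₁) / α ^ 2 := by
      rw [hP, hcc]; field_simp; ring
    have e2 : (2 * η * c₁) / α ^ 2 + (94 * e5 / T) / α ^ 2 = E₁ / α ^ 2 := by rw [hE₁]; ring
    linarith only [h, hmono, e, e2]
  have hb2 : ∀ α ∈ Set.Icc α₁ αm, Iα α - X α ≤ Q' / α ^ 2 + cc := by
    intro α hα
    have hα0' : 0 < α := hα₁0.trans_le hα.1
    have h := hper (h01.trans hα.1) hα.2
    have hmin : min c₃ (1 / α) ≤ 1 / α := min_le_right _ _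
    have hmono : 2 * η * (c₁ / α + c₂ * min c₃ (1 / α) + c₄ * α) / α ≤ 2 * η * (c₁ / α + c₂ * (1 / α) + c₄ * α) / α := by
      gcongr
    have e : 2 * η * (c₁ / α + c₂ * (1 / α) + c₄ * α) / α = (2 * η * (c₁ + c₂)) / α ^ 2 + cc := by
      rw [hcc]; field_simp
    have e2 : (2 * η * (c₁ + c₂)) / α ^ 2 + (94 * e5 / T) / α ^ 2 = Q' / α ^ 2 := by rw [hQ']; ring
    linarith only [h, hmono, e, e2]
  have hb3 : ∀ α ∈ Set.Icc αm 1, Iα α - X α ≤ Qc / α ^ 2 := by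
    intro α hα
    have hα0' : 0 < α := hαm0.trans_le hα.1
    have hα1' : α ≤ 1 := hα.2
    have hB := inner_integral_restr_interval_le hsys hg hg1 hgb hxN3 hx1 hC0 hC hα0' hα1' hT21 hQ hblkQ
      hν hν2 (B := e12 / α) (by positivity) (by rw [he12]) (fun y _ => hcrude hα0' hα1' y)
    have hXα : X α = e12 * (Real.sqrt G + m * Real.sqrt (8 * η ^ 2 * Real.log Q + G)) / (α * Real.sqrt α) +
        (32 / Real.sqrt (T / 2) + 90 / (T / 2)) / Real.sqrt α := by
      simp only [hX, hF, hGh]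
    have hmain : 2 * (ν - 1) * (e12 / α) / α = 2 * η * e12 / α ^ 2 := by rw [hη]; field_simp
    have htail : 47 * Real.exp 5 / (α ^ 2 * (T / 2)) = (94 * e5 / T) / α ^ 2 := by
      rw [he5]; field_simp; ring
    have e : 2 * η * e12 / α ^ 2 + (94 * e5 / T) / α ^ 2 = Qc / α ^ 2 := by rw [hQc]; ring
    simp only [hI]
    rw [hm, hη, hG, he12] at hXα
    linarith only [hB, hXα, hmain, htail, e]
  have hĨint : IntegrableOn (fun α => Iα α - X α) (Set.Ioc α₀ 1) := hIint.sub hXint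
  have hB3 := setIntegral_le_of_three_regimes hα₀0 h01 h12 h2 hĨint hcc0 hE₁0 hQ'0 hQc0 hb1 hb2 hb3
  have hIsplit : ∫ α in Set.Ioc α₀ 1, Iα α = (∫ α in Set.Ioc α₀ 1, (Iα α - X α)) + ∫ α in Set.Ioc α₀ 1, X α := by
    rw [← integral_add hĨint hXint]
    exact integral_congr_ae (Filter.Eventually.of_forall fun α => by simp only [hX]; ring)
  have hfin : ∫ α in Set.Ioc α₀ 1, Iα α ≤
      P * Real.log (α₁ / α₀) + cc + E₁ / α₀ + Q' / α₁ + Qc / αm + (2 * F / Real.sqrt α₀ + 2 * Gh) := by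
    rw [hIsplit]; linarith only [hB3, hXle]
  simpa only [hI, hP, hcc, hE₁, hQ', hQc, hF, hG, hGh, hη, hm, he5, he12, ha_def, hN] using hfin

set_option maxHeartbeats 1600000 in
/-- **Halász's theorem for block-restricted sums over multiplicative windows, WITHOUT the polynomial factor.**
From any Vinogradov–Korobov region (`HasVKZeroFreeRegion cVK TVK`, `cVK > 0`; proved in the tree) there are
`K > 0`, `C_r ≥ 0` such that for all large `x`, every completely multiplicative `g` with `|g| ≤ 1`, `4 ≤ T ≤ νx`,
`e² ≤ Q ≤ exp(√log(νx) + 1)`, `1 < ν ≤ 2`, every block system of primes `≤ Q` at level `⌊νx⌋`, writing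
`M = M(νx, T) = min_{|t| ≤ T} 𝔻(g, n^{it}; νx)²` (the FULL distance, `Sieve.minPretentiousDistSq`), in the regime
`34 M + C_r ≤ log log x`:

`|∑_{x < n ≤ νx, n ∈ 𝒮} g(n)| ≤ K ( (ν-1) x ( e^{-M/2} + 1/T + (|𝓙|+1)√((log Q + 2)/log x) + √(log x)/T )`
`   + (|𝓙|+1) x (ν-1)^{-1/12}/√(log x) + x/log x + x/T + |E| )`.

Compared with `norm_restr_interval_sum_le` (main term `(1 + M_½) e^{-M_½}`, `M_½ ≥ M/2`): the same `e^{-M/2}` decay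
but NO factor `(1 + M_½)` — squared over the window `|t - t₁| ≤ (log X)^{1/16}` (Gallagher) this is the middle term
`e^{-M}` of Matomäki–Radziwiłł–Tao 2015, Proposition A.3 AS PRINTED, for completely multiplicative `f`.  Proof: the
Granville–Soundararajan method exactly as in `norm_restr_interval_sum_le`, with the uniform line bound replaced by
the sharp per-`α` profile `Sharp.norm_LSeries_restr_sharp` (its side conditions from `Sharp.regime_facts`) and the
two-regime integration by `integral_profile_le` (logarithmic piece only up to `α₁ = e^{M-d}/log νx`,
`Sharp.key_log_ineq`, `Sharp.key_inv_ineq`).  Outside the regime use `norm_restr_interval_sum_le`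
(there `(1 + M/2) e^{-M/2+O(1)} ≤ (log x)^{-1/70}`). [cite: GranvilleSoundararajan2003, §4]
[cite: MatomakiRadziwillTao2015, Appendix A, Proposition A.3] -/
theorem norm_restr_interval_sum_le_sharp {cVK TVK : ℝ} (hcVK : 0 < cVK) (hVK : HasVKZeroFreeRegion cVK TVK) :
    ∃ K Cr : ℝ, 0 < K ∧ 0 ≤ Cr ∧ ∀ᶠ x : ℝ in atTop, ∀ (𝓙 : Finset ℕ) (blk : ℕ → Finset ℕ) (g : ℕ → ℂ),
      (∀ m n, g (m * n) = g m * g n) → g 1 = 1 → (∀ n, ‖g n‖ ≤ 1) →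
      ∀ T Q ν : ℝ, 4 ≤ T → T ≤ ν * x → Real.exp 2 ≤ Q → Q ≤ Real.exp (Real.sqrt (Real.log (ν * x)) + 1) →
      1 < ν → ν ≤ 2 → IsBlockSystem 𝓙 blk ⌊ν * x⌋₊ → (∀ i ∈ 𝓙, ∀ p ∈ blk i, (p : ℝ) ≤ Q) →
      34 * minPretentiousDistSq g (ν * x) T + Cr ≤ Real.log (Real.log x) →
        ‖S (restr 𝓙 blk g ⌊ν * x⌋₊) (ν * x) - S (restr 𝓙 blk g ⌊ν * x⌋₊) x‖ ≤ K *
          ((ν - 1) * x * (Real.exp (-(minPretentiousDistSq g (ν * x) T) / 2) + 1 / T +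
              (𝓙.card + 1) * Real.sqrt ((Real.log Q + 2) / Real.log x) + Real.sqrt (Real.log x) / T) +
            (𝓙.card + 1) * x * (ν - 1) ^ (-(1 / 12 : ℝ)) / Real.sqrt (Real.log x) +
            x / Real.log x + x / T + (𝓙.biUnion blk).card) := by
  classical
  obtain ⟨C₂, hC₂⟩ := exists_sum_abs_psi_sub_mul_kk_le
  obtain ⟨Cθ', hCθ'⟩ := Literature.NumberTheory.LFunctions.ChebyshevThetaDeLaValleePoussin_holds.logPow 6
  set Cθ : ℝ := max Cθ' 0 with hCθdef
  have hCθ0 : 0 ≤ Cθ := le_max_right _ _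
  have hCθ : ∀ z : ℝ, 2 ≤ z → |Chebyshev.theta z - z| ≤ Cθ * z / Real.log z ^ (6 : ℝ) := by
    intro z hz
    refine (hCθ' z hz).trans ?_
    have hlogz : 0 < Real.log z ^ (6 : ℝ) := Real.rpow_pos_of_pos (Real.log_pos (by linarith)) _
    exact div_le_div_of_nonneg_right (mul_le_mul_of_nonneg_right (le_max_left _ _) (by linarith)) hlogz.le
  -- the clustering lemma at `θ = 7/10`
  obtain ⟨Ccl, hCcl0, hclev⟩ := Sharp.twist_cluster_of_vk hcVK hVK (θ := 7 / 10) (by norm_num)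
  obtain ⟨X₁, hX₁⟩ := Filter.eventually_atTop.mp hclev
  set e5 : ℝ := Real.exp 5 with he5
  set e7 : ℝ := Real.exp 7 with he7
  set e12 : ℝ := Real.exp 12 with he12
  set e13 : ℝ := Real.exp 13 with he13
  set KC : ℝ := 1 + (3 * Cθ) ^ (1 / 6 : ℝ) with hKC
  have hKC1 : 1 ≤ KC := by
    have : 0 ≤ (3 * Cθ) ^ (1 / 6 : ℝ) := Real.rpow_nonneg (by positivity) _
    rw [hKC]; linarith
  set cG : ℝ := Real.sqrt (272 * KC) with hcG
  have hcG0 : 0 ≤ cG := Real.sqrt_nonneg _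
  set K : ℝ := (272 * e13 + 204 * e12 + 2) + 1100 * e12 + 9588 * e5 + (140 * e12 + 2) + 49 * cG * e12 +
    (2312 + (3 * |C₂| + 10)) + 4 + e7 + 1 with hK
  set Cr : ℝ := 203 + 4 * Ccl with hCr
  have he5pos : 0 < e5 := Real.exp_pos _
  have he7pos : 0 < e7 := Real.exp_pos _
  have he12pos : 0 < e12 := Real.exp_pos _
  have he13pos : 0 < e13 := Real.exp_pos _
  have hKpos : 0 < K := by positivity
  have hprod3 : 0 ≤ cG * e12 := by positivity
  have hKrest : 0 ≤ (272 * e13 + 204 * e12 + 2) + 1100 * e12 + 9588 * e5 + (140 * e12 + 2) + 49 * cG * e12 +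
      (2312 + (3 * |C₂| + 10)) + 4 := by positivity
  have hK1 : 1 ≤ K := by rw [hK]; linarith [he7pos.le, hKrest]
  refine ⟨K, Cr, hKpos, by positivity, ?_⟩
  filter_upwards [Filter.eventually_ge_atTop (3 : ℝ), Filter.eventually_ge_atTop X₁] with x hx hxX₁
  intro 𝓙 blk g hg hg1 hgb T Q ν hT hTx hQ hQle hν hν2 hsys hblkQ hregime
  set N : ℕ := ⌊ν * x⌋₊ with hN
  set a := restr 𝓙 blk g N with ha_def
  have hab : ∀ n, ‖a n‖ ≤ 1 := norm_restr_le_one hgb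
  set E := 𝓙.biUnion blk with hE
  set xN : ℝ := ν * x with hxN
  set M : ℝ := minPretentiousDistSq g xN T with hM
  set Φ : ℝ := Real.exp (-M / 2) with hΦ
  set ℓ : ℝ := Real.log x with hℓ
  set ℓN : ℝ := Real.log xN with hℓNdef
  set m : ℝ := (𝓙.card : ℝ) with hm
  set ρ : ℝ := Real.sqrt ((Real.log Q + 2) / ℓ) with hρ
  set η : ℝ := ν - 1 with hη
  have hx0 : 0 < x := by linarith
  have hx1 : 1 ≤ x := by linarith
  have hη0 : 0 < η := by rw [hη]; linarith
  have hη1 : η ≤ 1 := by rw [hη]; linarith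
  have hxN3 : 3 ≤ xN := by rw [hxN]; nlinarith
  have hxNx : x ≤ xN := by rw [hxN]; nlinarith
  have hxN2x : xN ≤ 2 * x := by rw [hxN]; nlinarith
  have hxN0 : 0 < xN := by linarith
  have hℓ1 : 1 < ℓ := by
    rw [hℓ, ← Real.log_exp 1]
    exact Real.log_lt_log (Real.exp_pos 1) (by have := Real.exp_one_lt_d9; linarith)
  have hℓ0 : 0 < ℓ := by linarith
  have hlog2 : Real.log 2 < 1 := by have := Real.log_two_lt_d9; linarith
  have hℓN : ℓ ≤ ℓN := Real.log_le_log hx0 hxNx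
  have hℓN2 : ℓN ≤ 2 * ℓ := by
    calc ℓN ≤ Real.log (2 * x) := Real.log_le_log (by linarith) hxN2x
      _ = Real.log 2 + ℓ := by rw [Real.log_mul (by norm_num) hx0.ne', hℓ]
      _ ≤ 2 * ℓ := by linarith
  have hℓN0 : 0 < ℓN := by linarith
  have hT0 : 0 < T := by linarith
  have hQ0 : 0 < Q := lt_of_lt_of_le (Real.exp_pos 2) hQ
  have hQ3 : 3 ≤ Q := le_trans (by have := Real.add_one_le_exp (2:ℝ); linarith) hQ
  have hlogQ2 : 2 ≤ Real.log Q := by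
    rw [← Real.log_exp 2]; exact Real.log_le_log (Real.exp_pos 2) hQ
  have hlogQ : Real.log Q ≤ Real.sqrt ℓN + 1 := by
    have := Real.log_le_log hQ0 hQle
    rwa [Real.log_exp] at this
  have hM0 : 0 ≤ M := Sieve.minPretentiousDistSq_nonneg hgb xN (by linarith)
  have hΦ0 : 0 < Φ := Real.exp_pos _
  have hΦ1 : Φ ≤ 1 := by rw [hΦ, ← Real.exp_zero]; exact Real.exp_le_exp.2 (by linarith)
  have hm0 : 0 ≤ m := Nat.cast_nonneg _
  have hρ0 : 0 ≤ ρ := Real.sqrt_nonneg _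
  have hcard0 : (0 : ℝ) ≤ E.card := Nat.cast_nonneg _
  -- Mertens for the `E`-terms
  set L : ℝ := Real.log Q + Real.log 4 with hLdef
  have hEsub : E ⊆ Nat.primesLE ⌊Q⌋₊ := by
    intro p hp
    rw [hE, Finset.mem_biUnion] at hp
    obtain ⟨i, hi, hpi⟩ := hp
    rw [Nat.mem_primesLE]
    exact ⟨Nat.le_floor (hblkQ i hi p hpi), hsys.prime_of_mem hi hpi⟩
  have hL : ∑ p ∈ E, Real.log p / p ≤ L := by
    have h1 : ∑ p ∈ E, Real.log p / p ≤ ∑ p ∈ Nat.primesLE ⌊Q⌋₊, Real.log p / p :=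
      Finset.sum_le_sum_of_subset_of_nonneg hEsub fun p hp _ => by
        rw [Nat.mem_primesLE] at hp
        exact div_nonneg (Real.log_nonneg (by exact_mod_cast hp.2.one_lt.le)) (Nat.cast_nonneg p)
    refine h1.trans ((MertensBound.sum_log_div_prime_le ⌊Q⌋₊).trans ?_)
    rw [hLdef]
    gcongr
    · exact Nat.cast_pos.mpr (Nat.floor_pos.mpr (by linarith only [hQ, Real.add_one_le_exp (2:ℝ)]))
    · exact Nat.floor_le hQ0.le
  have hlog4 : Real.log 4 ≤ 2 := by
    have h2 : Real.log 4 = 2 * Real.log 2 := by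
      rw [show (4:ℝ) = 2 ^ 2 by norm_num, Real.log_pow]; ring
    rw [h2]; linarith only [Real.log_two_lt_d9]
  have hL0 : 0 ≤ L := by
    rw [hLdef]; have := Real.log_nonneg (show (1:ℝ) ≤ 4 by norm_num); linarith only [this, hlogQ2]
  have hLle' : L ≤ Real.sqrt ℓN + 3 := by rw [hLdef]; linarith
  -- the regime and the scale `α_m = e^{M/2}/ℓN`
  have hregℓ : 34 * M + 203 + 4 * Ccl ≤ Real.log ℓ := by rw [hCr] at hregime; linarith
  obtain ⟨heM2ℓ, hαm1, hαminv, hzx, hwz, hQw, hreg, hfr, hℓN32⟩ :=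
    Sharp.regime_facts hM0 hℓ1 hℓN hxN3 hℓNdef hQle hCcl0 hregℓ hL0 hLle'
  set αm : ℝ := Real.exp (M / 2) / ℓN with hαm
  have hαm0 : 0 < αm := by positivity
  -- `K₀ = ∑_{p ∈ E} 1/p`, `e^{K₀} ≤ e⁴ √ℓN`
  set K₀ : ℝ := ∑ p ∈ E, (1 : ℝ) / p with hK₀
  have heK₀ : Real.exp K₀ ≤ 2 * Real.exp 4 * Real.sqrt ℓN := by
    have h1 : K₀ ≤ ∑ p ∈ Nat.primesLE ⌊Q⌋₊, (1 : ℝ) / p :=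
      Finset.sum_le_sum_of_subset_of_nonneg hEsub fun p _ _ => by positivity
    have h2 := sum_primesLE_inv_le hQ3
    have hs1 : 1 ≤ Real.sqrt ℓN := by rw [← Real.sqrt_one]; exact Real.sqrt_le_sqrt (by linarith)
    have h3 : Real.log (Real.log Q) ≤ Real.log 2 + Real.log ℓN / 2 := by
      calc Real.log (Real.log Q) ≤ Real.log (2 * Real.sqrt ℓN) := Real.log_le_log (by linarith) (by linarith)
        _ = Real.log 2 + Real.log (Real.sqrt ℓN) := Real.log_mul (by norm_num) (by linarith)
        _ = Real.log 2 + Real.log ℓN / 2 := by rw [Real.log_sqrt hℓN0.le]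
    calc Real.exp K₀ ≤ Real.exp (Real.log 2 + Real.log ℓN / 2 + 4) := Real.exp_le_exp.2 (by linarith)
      _ = 2 * Real.exp 4 * Real.sqrt ℓN := by
          rw [show Real.log 2 + Real.log ℓN / 2 + 4 = Real.log 2 + (4 + Real.log ℓN / 2) by ring, Real.exp_add,
            Real.exp_log (by norm_num), Real.exp_add, ← Real.log_sqrt hℓN0.le,
            Real.exp_log (Real.sqrt_pos.mpr hℓN0)]
          ring
  -- the clustering inequality at `X = 2 xN` and the sharp per-`α` bound
  have hX2 : X₁ ≤ 2 * xN := by linarith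
  have hcl := hX₁ (2 * xN) hX2 g hgb
  obtain ⟨d, hd0, hsharp⟩ := Sharp.norm_LSeries_restr_sharp hsys hg hg1 hgb hxN3 hT hTx hblkQ hQw
    (C := Ccl) (fun t t₁ z h1 h2 h3 => hcl t t₁ z h1 h2 h3) hαm0 hαm1 hzx hwz hL hreg hfr
  -- the profile constants
  set c₁ : ℝ := e12 * Φ with hc₁
  set c₂ : ℝ := e13 * Real.exp (-d / 2) with hc₂
  set c₃ : ℝ := ℓN * Real.exp (-(M - d)) with hc₃
  set c₄ : ℝ := Real.exp (K₀ + 8) * 4 * ℓN / T with hc₄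
  have hc₁0 : 0 ≤ c₁ := by positivity
  have hc₂0 : 0 ≤ c₂ := by positivity
  have hc₃0 : 0 ≤ c₃ := by positivity
  have hc₄0 : 0 ≤ c₄ := by positivity
  have hsharpB : ∀ α : ℝ, 0 < α → α ≤ αm → ∀ y : ℝ, |y| ≤ T / 2 →
      ‖LSeries (restr 𝓙 blk g ⌊xN⌋₊) (1 + α + y * I)‖ ≤ c₁ / α + c₂ * min c₃ (1 / α) + c₄ * α := by
    intro α hα hα2 y hy
    have h := hsharp α hα hα2 y hy
    have e : Real.exp 12 * Real.exp (-(minPretentiousDistSq g xN T) / 2) / α +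
        Real.exp 13 * Real.exp (-d / 2) * min (Real.log xN * Real.exp (-(minPretentiousDistSq g xN T - d))) (1 / α) +
        Real.exp (∑ p ∈ 𝓙.biUnion blk, (1 : ℝ) / p + 8) * (4 * α / T) * Real.log xN =
        c₁ / α + c₂ * min c₃ (1 / α) + c₄ * α := by
      rw [hc₁, hc₂, hc₃, hc₄, he12, he13, hΦ, hK₀, hM, hℓNdef, hE]; ring
    rw [← e]; exact h
  -- the three regimes and the `α`-integral
  set α₀ : ℝ := 1 / (2 * ℓ) with hα₀
  set α₁ : ℝ := max α₀ (min (Real.exp (M - d) / ℓN) αm) with hα₁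
  have hα₀0 : 0 < α₀ := by positivity
  have h02 : α₀ ≤ αm := by
    rw [hα₀, hαm, div_le_div_iff₀ (by positivity) hℓN0]
    have h1 : 1 ≤ Real.exp (M / 2) := by rw [← Real.exp_zero]; exact Real.exp_le_exp.2 (by linarith)
    calc 1 * ℓN ≤ 1 * (2 * ℓ) := by linarith
      _ ≤ Real.exp (M / 2) * (2 * ℓ) := mul_le_mul_of_nonneg_right h1 (by linarith)
  have h01 : α₀ ≤ α₁ := le_max_left _ _
  have h12 : α₁ ≤ αm := max_le h02 (min_le_right _ _)
  have hα₁0 : 0 < α₁ := hα₀0.trans_le h01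
  have hT21 : (1 : ℝ) ≤ T / 2 := by linarith only [hT]
  have hprof := integral_profile_le hsys hg hg1 hgb hxN3 hx1 hCθ0 hCθ hT21 hQ hblkQ hν hν2 hα₀0 h01 h12 hαm1
    hc₁0 hc₂0 hc₃0 hc₄0 hsharpB
  -- Lemma A2 and the `α`-representation
  have hII := norm_Sh_restr_mul_log_le_integral hC₂ hsys hg hgb hL hν.le hν2 hx
  have hB1 := integral_normShExp_le (a := a) hab (N := N) (fun n => mulLog_restr_apply n) hν.le hν2 hx
  -- the `α`-integral in the units of the bound
  set G : ℝ := 16 * uPNT Cθ ν + 256 with hG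
  have hu₁1 : 1 ≤ uPNT Cθ ν := one_le_uPNT hCθ0 hν
  have hG0 : 0 ≤ G := by rw [hG]; linarith
  have hGle : G ≤ 272 * KC * η ^ (-(1 / 6 : ℝ)) := by
    have hu := uPNT_le hCθ0 hν hν2
    rw [← hKC, ← hη] at hu
    have h16 : 16 * uPNT Cθ ν ≤ 16 * (KC * η ^ (-(1 / 6 : ℝ))) := by linarith only [hu]
    have h256 : (256 : ℝ) ≤ 256 * (KC * η ^ (-(1 / 6 : ℝ))) := by
      have hpow : 1 ≤ η ^ (-(1 / 6 : ℝ)) := by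
        rw [Real.rpow_neg hη0.le, one_le_inv_iff₀]
        exact ⟨Real.rpow_pos_of_pos hη0 _, Real.rpow_le_one hη0.le hη1 (by norm_num)⟩
      have := one_le_mul_of_one_le_of_one_le hKC1 hpow
      linarith only [this]
    rw [hG]; linarith only [h16, h256]
  set F : ℝ := e12 * (Real.sqrt G + m * Real.sqrt (8 * η ^ 2 * Real.log Q + G)) with hF
  set Gh : ℝ := 32 / Real.sqrt (T / 2) + 90 / (T / 2) with hGh
  have hsqrtα₀ : 1 / Real.sqrt α₀ = Real.sqrt (2 * ℓ) := by
    rw [hα₀, Real.sqrt_div' 1 (by positivity : (0:ℝ) ≤ 2 * ℓ), Real.sqrt_one]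
    field_simp
  have hIle : ∫ α in Set.Ioc α₀ 1, (∫ u in Set.Ioc (Real.log 2) (Real.log x),
      ‖psum (mulLog a N) (ν * Real.exp u) - psum (mulLog a N) (Real.exp u)‖ * Real.exp (-((1 + 2 * α) * u))) ≤
      2 * η * (c₂ * c₃) * Real.log (α₁ / α₀) + 2 * η * c₄ + (2 * η * c₁ + 94 * e5 / T) / α₀ +
        (2 * η * (c₁ + c₂) + 94 * e5 / T) / α₁ + (2 * η * e12 + 94 * e5 / T) / αm +
        (2 * F * Real.sqrt (2 * ℓ) + 2 * Gh) := by
    have e : 2 * (ν - 1) * (c₂ * c₃) * Real.log (α₁ / α₀) + 2 * (ν - 1) * c₄ +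
        (2 * (ν - 1) * c₁ + 94 * Real.exp 5 / T) / α₀ + (2 * (ν - 1) * (c₁ + c₂) + 94 * Real.exp 5 / T) / α₁ +
        (2 * (ν - 1) * Real.exp 12 + 94 * Real.exp 5 / T) / αm +
        (2 * (Real.exp 12 * (Real.sqrt (16 * uPNT Cθ ν + 256) +
            𝓙.card * Real.sqrt (8 * (ν - 1) ^ 2 * Real.log Q + (16 * uPNT Cθ ν + 256)))) / Real.sqrt α₀ +
          2 * (32 / Real.sqrt (T / 2) + 90 / (T / 2))) =
        2 * η * (c₂ * c₃) * Real.log (α₁ / α₀) + 2 * η * c₄ + (2 * η * c₁ + 94 * e5 / T) / α₀ +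
        (2 * η * (c₁ + c₂) + 94 * e5 / T) / α₁ + (2 * η * e12 + 94 * e5 / T) / αm +
        (2 * F * Real.sqrt (2 * ℓ) + 2 * Gh) := by
      rw [hF, hG, hGh, hη, hm, he5, he12, ← hsqrtα₀]; ring
    rw [← e]; exact hprof
  -- key real inequalities
  have hkey1 : Real.exp (-d / 2) * Real.exp (-(M - d)) * Real.log (α₁ / α₀) ≤ 2 * Φ :=
    Sharp.key_log_ineq (M := M) (d := d) hℓ0 hℓN
  have hkey2 : Real.exp (-d / 2) / α₁ ≤ 2 * ℓN * Φ := Sharp.key_inv_ineq (M := M) hd0 hℓ0 hℓN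
  -- t1: `17 · 2η c₂c₃ log(α₁/α₀) · x ≤ 136 e13 ηxℓΦ`
  have ht1 : 17 * (2 * η * (c₂ * c₃) * Real.log (α₁ / α₀)) * x ≤ 136 * e13 * (η * x * Φ * ℓ) := by
    calc 17 * (2 * η * (c₂ * c₃) * Real.log (α₁ / α₀)) * x
        = 17 * x * (2 * η * e13 * ℓN) * (Real.exp (-d / 2) * Real.exp (-(M - d)) * Real.log (α₁ / α₀)) := by
          rw [hc₂, hc₃]; ring
      _ ≤ 17 * x * (2 * η * e13 * ℓN) * (2 * Φ) := mul_le_mul_of_nonneg_left hkey1 (by positivity)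
      _ = 68 * e13 * (η * x * Φ) * ℓN := by ring
      _ ≤ 68 * e13 * (η * x * Φ) * (2 * ℓ) := mul_le_mul_of_nonneg_left hℓN2 (by positivity)
      _ = 136 * e13 * (η * x * Φ * ℓ) := by ring
  -- t2: `17 · 2η c₄ · x ≤ 1100 e12 ηxℓ√ℓ/T`
  have ht2 : 17 * (2 * η * c₄) * x ≤ 1100 * e12 * (η * x * ℓ * Real.sqrt ℓ / T) := by
    have hsq2 : Real.sqrt ℓN ≤ Real.sqrt 2 * Real.sqrt ℓ := by
      rw [← Real.sqrt_mul (by norm_num)]; exact Real.sqrt_le_sqrt hℓN2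
    have hs2 : Real.sqrt 2 ≤ 1.42 := by rw [Real.sqrt_le_left (by norm_num)]; norm_num
    have h1 : Real.exp (K₀ + 8) * ℓN ≤ 2 * Real.exp 12 * (2 * ℓ) * (1.42 * Real.sqrt ℓ) := by
      rw [Real.exp_add]
      calc Real.exp K₀ * Real.exp 8 * ℓN ≤ (2 * Real.exp 4 * Real.sqrt ℓN) * Real.exp 8 * (2 * ℓ) := by
            gcongr
        _ = 2 * Real.exp 12 * (2 * ℓ) * Real.sqrt ℓN := by
            rw [show Real.exp 12 = Real.exp 4 * Real.exp 8 by rw [← Real.exp_add]; norm_num]; ring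
        _ ≤ 2 * Real.exp 12 * (2 * ℓ) * (1.42 * Real.sqrt ℓ) := by
            gcongr
            exact hsq2.trans (mul_le_mul_of_nonneg_right hs2 (Real.sqrt_nonneg ℓ))
    calc 17 * (2 * η * c₄) * x = (136 * η * x / T) * (Real.exp (K₀ + 8) * ℓN) := by rw [hc₄]; ring
      _ ≤ (136 * η * x / T) * (2 * Real.exp 12 * (2 * ℓ) * (1.42 * Real.sqrt ℓ)) :=
          mul_le_mul_of_nonneg_left h1 (by positivity)
      _ = (136 * 2 * 1.42 * 2) * e12 * (η * x * ℓ * Real.sqrt ℓ / T) := by rw [he12]; ring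
      _ ≤ 1100 * e12 * (η * x * ℓ * Real.sqrt ℓ / T) := by
          have h0 : 0 ≤ e12 * (η * x * ℓ * Real.sqrt ℓ / T) := by positivity
          have h1 : (136 * 2 * 1.42 * 2 : ℝ) ≤ 1100 := by norm_num
          have := mul_le_mul_of_nonneg_right h1 h0
          linarith
  -- t3: `17 (E₁/α₀) x = 68 e12 ηxℓΦ + 3196 e5 xℓ/T`
  have ht3 : 17 * ((2 * η * c₁ + 94 * e5 / T) / α₀) * x = 68 * e12 * (η * x * Φ * ℓ) + 3196 * e5 * (x * ℓ / T) := by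
    rw [hc₁, hα₀]; field_simp; ring
  -- t4: `17 (Q'/α₁) x ≤ (68 e12 + 136 e13) ηxℓΦ + 3196 e5 xℓ/T`
  have ht4 : 17 * ((2 * η * (c₁ + c₂) + 94 * e5 / T) / α₁) * x ≤
      (68 * e12 + 136 * e13) * (η * x * Φ * ℓ) + 3196 * e5 * (x * ℓ / T) := by
    have hinv0 : 1 / α₁ ≤ 2 * ℓ := by
      calc 1 / α₁ ≤ 1 / α₀ := one_div_le_one_div_of_le hα₀0 h01
        _ = 2 * ℓ := by rw [hα₀, one_div_one_div]
    have hsplit : 17 * ((2 * η * (c₁ + c₂) + 94 * e5 / T) / α₁) * x =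
        17 * x * (2 * η * e12 * Φ + 94 * e5 / T) * (1 / α₁) +
          17 * x * (2 * η * e13) * (Real.exp (-d / 2) / α₁) := by rw [hc₁, hc₂]; field_simp; ring
    rw [hsplit]
    have hA : 17 * x * (2 * η * e12 * Φ + 94 * e5 / T) * (1 / α₁) ≤
        17 * x * (2 * η * e12 * Φ + 94 * e5 / T) * (2 * ℓ) := mul_le_mul_of_nonneg_left hinv0 (by positivity)
    have hB : 17 * x * (2 * η * e13) * (Real.exp (-d / 2) / α₁) ≤ 17 * x * (2 * η * e13) * (2 * ℓN * Φ) :=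
      mul_le_mul_of_nonneg_left hkey2 (by positivity)
    have hC : 17 * x * (2 * η * e13) * (2 * ℓN * Φ) ≤ 136 * e13 * (η * x * Φ * ℓ) := by
      calc 17 * x * (2 * η * e13) * (2 * ℓN * Φ) = 68 * e13 * (η * x * Φ) * ℓN := by ring
        _ ≤ 68 * e13 * (η * x * Φ) * (2 * ℓ) := mul_le_mul_of_nonneg_left hℓN2 (by positivity)
        _ = 136 * e13 * (η * x * Φ * ℓ) := by ring
    have hD : 17 * x * (2 * η * e12 * Φ + 94 * e5 / T) * (2 * ℓ) =
        68 * e12 * (η * x * Φ * ℓ) + 3196 * e5 * (x * ℓ / T) := by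
      field_simp; ring
    linarith only [hA, hB, hC, hD]
  -- tQ: `17 (Qc/αm) x ≤ 68 e12 ηxℓΦ + 3196 e5 xℓ/T`
  have htQ : 17 * ((2 * η * e12 + 94 * e5 / T) / αm) * x ≤ 68 * e12 * (η * x * Φ * ℓ) + 3196 * e5 * (x * ℓ / T) := by
    have hinv : 1 / αm = ℓN * Φ := by rw [hαminv, hΦ]
    have hsplit : 17 * ((2 * η * e12 + 94 * e5 / T) / αm) * x =
        17 * x * (2 * η * e12) * (ℓN * Φ) + 17 * x * (94 * e5 / T) * (ℓN * Φ) := by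
      rw [div_eq_mul_one_div (2 * η * e12 + 94 * e5 / T) αm, hinv]; ring
    rw [hsplit]
    have hA : 17 * x * (2 * η * e12) * (ℓN * Φ) ≤ 68 * e12 * (η * x * Φ * ℓ) := by
      calc 17 * x * (2 * η * e12) * (ℓN * Φ) = 34 * e12 * (η * x * Φ) * ℓN := by ring
        _ ≤ 34 * e12 * (η * x * Φ) * (2 * ℓ) := mul_le_mul_of_nonneg_left hℓN2 (by positivity)
        _ = 68 * e12 * (η * x * Φ * ℓ) := by ring
    have hB : 17 * x * (94 * e5 / T) * (ℓN * Φ) ≤ 3196 * e5 * (x * ℓ / T) := by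
      have h1 : ℓN * Φ ≤ 2 * ℓ * 1 := mul_le_mul hℓN2 hΦ1 hΦ0.le (by positivity)
      have := mul_le_mul_of_nonneg_left h1 (by positivity : 0 ≤ 17 * x * (94 * e5 / T))
      have e : 17 * x * (94 * e5 / T) * (2 * ℓ * 1) = 3196 * e5 * (x * ℓ / T) := by field_simp; ring
      linarith
    linarith only [hA, hB]
  -- t5: the `F`-term
  have ht5 : 17 * (2 * F * Real.sqrt (2 * ℓ)) * x ≤
      49 * cG * e12 * ((m + 1) * x * η ^ (-(1 / 12 : ℝ)) * Real.sqrt ℓ) + 140 * e12 * (η * x * m * (ρ * ℓ)) := by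
    have h := Sharp.F_term_le (Q := Q) hKC1 hη0 hm0 hx0 hℓ0 (by linarith) hG0 hGle
    rw [hF, hcG, he12, hρ]
    exact h
  -- t6: `17 x · 2Gh ≤ 2312 x`
  have ht6 : 17 * (2 * Gh) * x ≤ 2312 * x := by
    have hGh68 : Gh ≤ 68 := by
      rw [hGh]
      have hs : Real.sqrt 2 ≤ Real.sqrt (T / 2) := Real.sqrt_le_sqrt (by linarith only [hT])
      have hs2 : (1.4 : ℝ) ≤ Real.sqrt 2 := by
        rw [Real.le_sqrt (by norm_num) (by norm_num)]; norm_num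
      have h1 : 32 / Real.sqrt (T / 2) ≤ 32 / 1.4 := div_le_div_of_nonneg_left (by norm_num) (by norm_num) (hs2.trans hs)
      have h2 : 90 / (T / 2) ≤ 45 := by rw [div_le_iff₀ (by linarith only [hT])]; linarith only [hT]
      have h3 : (32 : ℝ) / 1.4 ≤ 23 := by norm_num
      linarith only [h1, h2, h3]
    have := mul_le_mul_of_nonneg_right hGh68 hx0.le
    linarith only [this]
  -- t7: `x η (log ℓ + 2) ≤ 2 ηxℓΦ` (`log ℓ + 2 ≤ 2√ℓ ≤ 2 ℓ e^{-M/2}`)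
  have ht7 : x * (η * (Real.log ℓ + 2)) ≤ 2 * (η * x * Φ * ℓ) := by
    have h1 : Real.log ℓ + 2 ≤ 2 * Real.sqrt ℓ := Sharp.log_add_two_le_two_sqrt hℓ1.le
    have h2 : Real.sqrt ℓ ≤ ℓ * Φ := by
      have h3 : Real.sqrt ℓ * Real.exp (M / 2) ≤ ℓ := by
        calc Real.sqrt ℓ * Real.exp (M / 2) ≤ Real.sqrt ℓ * Real.sqrt ℓ :=
              mul_le_mul_of_nonneg_left heM2ℓ (Real.sqrt_nonneg _)
          _ = ℓ := Real.mul_self_sqrt hℓ0.le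
      have h4 : Real.exp (M / 2) * Φ = 1 := by
        rw [hΦ, ← Real.exp_add, show M / 2 + -M / 2 = 0 by ring, Real.exp_zero]
      calc Real.sqrt ℓ = Real.sqrt ℓ * Real.exp (M / 2) * Φ := by rw [mul_assoc, h4, mul_one]
        _ ≤ ℓ * Φ := mul_le_mul_of_nonneg_right h3 hΦ0.le
    calc x * (η * (Real.log ℓ + 2)) ≤ x * (η * (2 * Real.sqrt ℓ)) := by gcongr
      _ ≤ x * (η * (2 * (ℓ * Φ))) := by gcongr
      _ = 2 * (η * x * Φ * ℓ) := by ring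
  -- t8: `2L ηx ≤ 2 ηx (m+1) ρ ℓ` (using `ρ ≤ 1` or the trivial bound)
  -- t9: `2 |E| log(νx) ≤ 4 |E| ℓ`
  have ht9 : 2 * (E.card : ℝ) * Real.log (ν * x) ≤ 4 * (E.card * ℓ) := by
    have h1 : Real.log (ν * x) ≤ 2 * ℓ := hℓN2
    have := mul_le_mul_of_nonneg_left h1 hcard0
    linarith only [this]
  -- the target, split into its summands
  set R₁ : ℝ := η * x * (Φ + 1 / T + (m + 1) * ρ + Real.sqrt ℓ / T) with hR₁
  set R₂ : ℝ := (m + 1) * x * η ^ (-(1 / 12 : ℝ)) / Real.sqrt ℓ with hR₂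
  set Rtot : ℝ := R₁ + R₂ + x / ℓ + x / T + E.card with hRtot
  have hR₁in : 0 ≤ Φ + 1 / T + (m + 1) * ρ + Real.sqrt ℓ / T := by
    have h1 : 0 ≤ 1 / T := by positivity
    have h2 : 0 ≤ (m + 1) * ρ := mul_nonneg (by linarith) hρ0
    have h3 : 0 ≤ Real.sqrt ℓ / T := div_nonneg (Real.sqrt_nonneg ℓ) hT0.le
    linarith [hΦ0.le]
  have hR₁0 : 0 ≤ R₁ := mul_nonneg (mul_nonneg hη0.le hx0.le) hR₁in
  have hR₂0 : 0 ≤ R₂ :=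
    div_nonneg (mul_nonneg (mul_nonneg (by linarith) hx0.le) (Real.rpow_nonneg hη0.le _)) (Real.sqrt_nonneg ℓ)
  -- the trivial bound and the trivial case `ρ > 1`
  have hS0 : ‖Sh a ν x‖ ≤ η * x + 1 := norm_Sh_le' hab hν.le hx0.le
  by_cases hρ1 : 1 < ρ
  · have h1 : 1 ≤ (m + 1) * ρ := by
      have := mul_le_mul_of_nonneg_right (by linarith : (1:ℝ) ≤ m + 1) hρ0
      linarith
    have h2 : 1 ≤ Φ + 1 / T + (m + 1) * ρ + Real.sqrt ℓ / T := by
      have : 0 ≤ 1 / T := by positivity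
      have : 0 ≤ Real.sqrt ℓ / T := by positivity
      linarith [hΦ0.le]
    have hηx : η * x ≤ R₁ := by
      calc η * x = η * x * 1 := (mul_one _).symm
        _ ≤ η * x * (Φ + 1 / T + (m + 1) * ρ + Real.sqrt ℓ / T) := mul_le_mul_of_nonneg_left h2 (by positivity)
    have hrest : K * R₁ + K * 1 ≤ K * Rtot := by
      rw [← mul_add]; refine mul_le_mul_of_nonneg_left ?_ hKpos.le
      have : 0 ≤ x / T := by positivity
      have : 1 ≤ x / ℓ := by
        rw [le_div_iff₀ hℓ0, one_mul, hℓ]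
        have := Real.log_le_sub_one_of_pos hx0; linarith
      rw [hRtot]; linarith
    have hKR : η * x + 1 ≤ K * R₁ + K * 1 := by
      have := mul_le_mul_of_nonneg_right hK1 hR₁0
      linarith
    have hfin : ‖Sh a ν x‖ ≤ K * Rtot := by linarith
    simpa only [Sh, hRtot, hR₁, hR₂, hη, hm, hxN, hΦ, hM, hℓ] using hfin
  push Not at hρ1
  have ht8 : 2 * L * ((ν - 1) * x) ≤ 2 * (η * x * (m + 1) * (ρ * ℓ)) := by
    have hL2 : L ≤ Real.log Q + 2 := by rw [hLdef]; linarith only [hlog4]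
    have hρ2 : ρ ^ 2 = (Real.log Q + 2) / ℓ := by rw [hρ]; exact Real.sq_sqrt (by positivity)
    have hρℓ' : Real.log Q + 2 = ρ ^ 2 * ℓ := by rw [hρ2]; field_simp
    have hρρ : ρ ^ 2 ≤ ρ := by nlinarith only [hρ0, hρ1]
    have h3 : ρ ^ 2 * ℓ ≤ ρ * ℓ := mul_le_mul_of_nonneg_right hρρ hℓ0.le
    have h4 : ρ * ℓ ≤ (m + 1) * (ρ * ℓ) := le_mul_of_one_le_left (by positivity) (by linarith only [hm0])
    rw [← hη]
    calc 2 * L * (η * x) ≤ 2 * (Real.log Q + 2) * (η * x) := by gcongr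
      _ = 2 * (η * x) * (ρ ^ 2 * ℓ) := by rw [hρℓ']; ring
      _ ≤ 2 * (η * x) * ((m + 1) * (ρ * ℓ)) := by
          refine mul_le_mul_of_nonneg_left (h3.trans h4) (by positivity)
      _ = 2 * (η * x * (m + 1) * (ρ * ℓ)) := by ring
  -- assemble
  have hmain : ‖Sh a ν x‖ * ℓ ≤ K * Rtot * ℓ := by
    set U1 : ℝ := η * x * Φ * ℓ with hU1
    set U2 : ℝ := η * x * ℓ * Real.sqrt ℓ / T with hU2
    set U3 : ℝ := η * x * (m + 1) * (ρ * ℓ) with hU3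
    set U4 : ℝ := (m + 1) * x * η ^ (-(1 / 12 : ℝ)) * Real.sqrt ℓ with hU4
    set U5 : ℝ := x * ℓ / T with hU5
    set U6 : ℝ := (E.card : ℝ) * ℓ with hU6
    set U7 : ℝ := η * x * ℓ / T with hU7
    have hu1 : 0 ≤ U1 := by positivity
    have hu2 : 0 ≤ U2 := by positivity
    have hu3 : 0 ≤ U3 := mul_nonneg (mul_nonneg (mul_nonneg hη0.le hx0.le) (by linarith)) (mul_nonneg hρ0 hℓ0.le)
    have hu4 : 0 ≤ U4 :=
      mul_nonneg (mul_nonneg (mul_nonneg (by linarith) hx0.le) (Real.rpow_nonneg hη0.le _)) (Real.sqrt_nonneg ℓ)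
    have hu5 : 0 ≤ U5 := by positivity
    have hu6 : 0 ≤ U6 := mul_nonneg hcard0 hℓ0.le
    have hu7 : 0 ≤ U7 := by positivity
    have hu3' : η * x * m * (ρ * ℓ) ≤ U3 := by
      have h0 : 0 ≤ η * x * (ρ * ℓ) := by positivity
      calc η * x * m * (ρ * ℓ) = (η * x * (ρ * ℓ)) * m := by ring
        _ ≤ (η * x * (ρ * ℓ)) * (m + 1) := mul_le_mul_of_nonneg_left (by linarith only [hm0]) h0
        _ = U3 := by rw [hU3]; ring
    -- the target in units
    have hRℓ : K * Rtot * ℓ = K * (U1 + U7 + U3 + U2 + U4 + x + U5 + U6) := by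
      have hR₂ℓ : R₂ * ℓ = U4 := by
        rw [hR₂, hU4, div_mul_eq_mul_div, div_eq_iff (Real.sqrt_pos.mpr hℓ0).ne']
        calc (m + 1) * x * η ^ (-(1 / 12 : ℝ)) * ℓ
            = (m + 1) * x * η ^ (-(1 / 12 : ℝ)) * (Real.sqrt ℓ * Real.sqrt ℓ) := by rw [Real.mul_self_sqrt hℓ0.le]
          _ = (m + 1) * x * η ^ (-(1 / 12 : ℝ)) * Real.sqrt ℓ * Real.sqrt ℓ := by ring
      have hxℓ : x / ℓ * ℓ = x := by field_simp
      have hR₁ℓ : R₁ * ℓ = U1 + U7 + U3 + U2 := by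
        rw [hR₁, hU1, hU7, hU3, hU2]; ring
      calc K * Rtot * ℓ = K * (R₁ * ℓ + R₂ * ℓ + x / ℓ * ℓ + x / T * ℓ + E.card * ℓ) := by rw [hRtot]; ring
        _ = K * (U1 + U7 + U3 + U2 + U4 + x + U5 + U6) := by
            rw [hR₂ℓ, hxℓ, hR₁ℓ, hU5, hU6]
            ring
    -- the sum of the term estimates, in units
    have hsum : 17 * (2 * η * (c₂ * c₃) * Real.log (α₁ / α₀)) * x + 17 * (2 * η * c₄) * x +
        17 * ((2 * η * c₁ + 94 * e5 / T) / α₀) * x + 17 * ((2 * η * (c₁ + c₂) + 94 * e5 / T) / α₁) * x +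
        17 * ((2 * η * e12 + 94 * e5 / T) / αm) * x + 17 * (2 * F * Real.sqrt (2 * ℓ)) * x + 17 * (2 * Gh) * x +
        x * (η * (Real.log ℓ + 2)) +
        (3 * |C₂| + 10) * x + 2 * L * ((ν - 1) * x) + 2 * (E.card : ℝ) * Real.log (ν * x) ≤
        (272 * e13 + 204 * e12 + 2) * U1 + 1100 * e12 * U2 + (140 * e12 + 2) * U3 +
          49 * cG * e12 * U4 + 9588 * e5 * U5 + (2312 + (3 * |C₂| + 10)) * x + 4 * U6 := by
      have h5 : 17 * (2 * F * Real.sqrt (2 * ℓ)) * x ≤ 49 * cG * e12 * U4 + 140 * e12 * U3 := by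
        have := ht5
        have h136 : 140 * e12 * (η * x * m * (ρ * ℓ)) ≤ 140 * e12 * U3 := mul_le_mul_of_nonneg_left hu3' (by positivity)
        linarith only [this, h136]
      linarith only [ht1, ht2, ht3, ht4, htQ, h5, ht6, ht7, ht8, ht9]
    -- the coefficients are `≤ K`
    have p5 := he5pos.le; have p7 := he7pos.le; have p12 := he12pos.le; have p13 := he13pos.le
    have pC := abs_nonneg C₂
    have hc1 : 272 * e13 + 204 * e12 + 2 ≤ K := by rw [hK]; linarith only [hprod3, p5, p7, p12, p13, pC]
    have hc2 : 1100 * e12 ≤ K := by rw [hK]; linarith only [hprod3, p5, p7, p12, p13, pC]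
    have hc3 : 140 * e12 + 2 ≤ K := by rw [hK]; linarith only [hprod3, p5, p7, p12, p13, pC]
    have hc4 : 49 * cG * e12 ≤ K := by rw [hK]; linarith only [hprod3, p5, p7, p12, p13, pC]
    have hc5 : 9588 * e5 ≤ K := by rw [hK]; linarith only [hprod3, p5, p7, p12, p13, pC]
    have hc6 : 2312 + (3 * |C₂| + 10) ≤ K := by rw [hK]; linarith only [hprod3, p5, p7, p12, p13, pC]
    have hc7 : (4 : ℝ) ≤ K := by rw [hK]; linarith only [hprod3, p5, p7, p12, p13, pC]
    have hs1 := mul_le_mul_of_nonneg_right hc1 hu1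
    have hs2 := mul_le_mul_of_nonneg_right hc2 hu2
    have hs3 := mul_le_mul_of_nonneg_right hc3 hu3
    have hs4 := mul_le_mul_of_nonneg_right hc4 hu4
    have hs5 := mul_le_mul_of_nonneg_right hc5 hu5
    have hs6 := mul_le_mul_of_nonneg_right hc6 hx0.le
    have hs7 := mul_le_mul_of_nonneg_right hc7 hu6
    have hK7 : 0 ≤ K * U7 := by positivity
    calc ‖Sh a ν x‖ * ℓ ≤ x * (∫ u in Real.log 2..Real.log x, normShExp a ν u) +
          (3 * |C₂| + 10) * x + 2 * L * ((ν - 1) * x) + 2 * (E.card : ℝ) * Real.log (ν * x) := hII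
      _ ≤ x * (17 * (∫ α in Set.Ioc α₀ 1, (∫ u in Set.Ioc (Real.log 2) (Real.log x),
            ‖psum (mulLog a N) (ν * Real.exp u) - psum (mulLog a N) (Real.exp u)‖ * Real.exp (-((1 + 2 * α) * u)))) +
            η * (Real.log ℓ + 2)) +
          (3 * |C₂| + 10) * x + 2 * L * ((ν - 1) * x) + 2 * (E.card : ℝ) * Real.log (ν * x) := by
          have := mul_le_mul_of_nonneg_left hB1 hx0.le
          rw [← hη] at this
          linarith only [this]
      _ ≤ x * (17 * (2 * η * (c₂ * c₃) * Real.log (α₁ / α₀) + 2 * η * c₄ + (2 * η * c₁ + 94 * e5 / T) / α₀ +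
            (2 * η * (c₁ + c₂) + 94 * e5 / T) / α₁ + (2 * η * e12 + 94 * e5 / T) / αm +
            (2 * F * Real.sqrt (2 * ℓ) + 2 * Gh)) + η * (Real.log ℓ + 2)) +
          (3 * |C₂| + 10) * x + 2 * L * ((ν - 1) * x) + 2 * (E.card : ℝ) * Real.log (ν * x) := by
          have h17 := mul_le_mul_of_nonneg_left hIle (by norm_num : (0:ℝ) ≤ 17)
          have := mul_le_mul_of_nonneg_left (add_le_add_right h17 (η * (Real.log ℓ + 2))) hx0.le
          linarith only [this]
      _ = 17 * (2 * η * (c₂ * c₃) * Real.log (α₁ / α₀)) * x + 17 * (2 * η * c₄) * x +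
            17 * ((2 * η * c₁ + 94 * e5 / T) / α₀) * x + 17 * ((2 * η * (c₁ + c₂) + 94 * e5 / T) / α₁) * x +
            17 * ((2 * η * e12 + 94 * e5 / T) / αm) * x + 17 * (2 * F * Real.sqrt (2 * ℓ)) * x + 17 * (2 * Gh) * x +
            x * (η * (Real.log ℓ + 2)) +
            (3 * |C₂| + 10) * x + 2 * L * ((ν - 1) * x) + 2 * (E.card : ℝ) * Real.log (ν * x) := by ring
      _ ≤ (272 * e13 + 204 * e12 + 2) * U1 + 1100 * e12 * U2 + (140 * e12 + 2) * U3 +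
          49 * cG * e12 * U4 + 9588 * e5 * U5 + (2312 + (3 * |C₂| + 10)) * x + 4 * U6 := hsum
      _ ≤ K * U1 + K * U2 + K * U3 + K * U4 + K * U5 + K * x + K * U6 + K * U7 := by
          linarith only [hs1, hs2, hs3, hs4, hs5, hs6, hs7, hK7]
      _ = K * Rtot * ℓ := by rw [hRℓ]; ring
  -- divide by `log x`
  have hfinal : ‖Sh a ν x‖ ≤ K * Rtot := le_of_mul_le_mul_right hmain hℓ0
  simpa only [Sh, hRtot, hR₁, hR₂, hη, hm, hxN, hΦ, hM, hℓ] using hfinal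

end Restricted

end Halasz

end Literature.NumberTheory.LFunctions
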